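import Literature.AlgebraicGeometry.Resolution.WeightedResolutionDatum
import Literature.AlgebraicGeometry.Resolution.RegularSubschemeLocallyIrreducible
import Literature.AlgebraicGeometry.Resolution.StrictNormalCrossingsDescent
import Literature.AlgebraicGeometry.Resolution.MarkedIdealsLemmas
import Literature.AlgebraicGeometry.Resolution.AlterationsLemma32
import Literature.AlgebraicGeometry.Hironaka2017.Lib.RsopSpread
import Literature.AlgebraicGeometry.Resolution.CotangentIndependenceSpread
import Literature.AlgebraicGeometry.Resolution.SmoothStalksRegular
import Mathlib
import Literature.AlgebraicGeometry.Resolution.CobordantBlowupRegularCentre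
import Literature.AlgebraicGeometry.Resolution.CobordantBlowupExtReesBridge
import Literature.AlgebraicGeometry.Resolution.FormalNormalCrossingsAlgebra
import Literature.AlgebraicGeometry.Resolution.RegularLocalOrderValuation
import Literature.AlgebraicGeometry.Resolution.RegularLocalRingsQuotient
import Literature.FieldTheory.Separability.FormallySmoothAlgebraic
import HarnessLib

/-!
# Weighted centre germs at points of a regular scheme: regular-subscheme centres, algebraization, steepening, the canonical contact filtration, uniqueness of the height-two weighted contact, residue fields (re-homed proofs, file 1 of 2)

Family `resolution` material RE-HOMED into `Literature/` by the Hodge foundations lane (`lit-hodgefound`, seat p20, generation 35),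
file 1 of 2: verbatim ports, in dependency order and each with its original module docstring (Parts 1–6), of the route
`ResolutionOfSingularities/WeightedInvariant` modules `Summits/ResolutionOfSingularities/ResolutionOfSingularities/Theorems/{WeightedInvariantRegularSubschemeCentre,
WeightedInvariantHypersurfaceCentreAlgebraize, WeightedInvariantHypersurfaceLocalGameEFTDimTwoSteepening, WeightedInvariantContactFiltrationCanonical,
AQSHeightTwoWeightedContactUnique, WeightedInvariantAQSBaseChangeResidueField}.lean` (door crux `HypersurfaceCentreConstruction`,
stmt-ResolutionOfSingularities-19897; cell seats res-D-pv-025 / res-type-047 and predecessors), namespace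
`Summit.ResolutionOfSingularities.ResolutionOfSingularities.Theorems` (with its sub-namespaces `LocalGameEFTSteepening`,
`ContactFiltration`, `AQSHeightTwo`, `AQSBaseChange`) re-rooted as `Literature.AlgebraicGeometry.Resolution.WeightedInvariant`; theorems
only (no definition, no named fact), imports Literature/Mathlib only; all `[folklore]` helpers privatised; `open` commands made
`_root_`-explicit.  CONTENT (weighted centres of marked ideals at points of a regular scheme, after Włodarczyk 2022 §2/§4 and
Abramovich–Temkin–Włodarczyk; Abramovich–Quek–Schober 2025 §3 for hypersurfaces at height-two points): unit-weight monomial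
ideals vs powers of a regular-subscheme centre and the regular loci of the quotients (Part 1), jets and algebraization of
hypersurface weighted centres (Part 2), the dimension-two local game — steepening moves `y ↦ y − c x^b` (Part 3), the CANONICAL
contact filtration (Part 4), uniqueness of the weighted contact at height two (Part 5), residue fields under base change
(Part 6).  WHY: this is the lower part of the import cone of the sibling file `AQSSeparableBaseChangeHolds` (file 2 of 2), which
carries the only proof in the tree of the Literature named fact `AlgebraicGeometry.Resolution.AbramovichQuekSchober2025_separableBaseChange`;
`Literature/` could not import the Summits originals.  The Summits originals stay in place (transitional duplication; cited here).
Honest framing of the originals stands: kernel theorems about weighted-centre germs; nothing here is a claim about H. Hironaka's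
manuscript or about resolution in positive characteristic; AI-written, weaker than expert review.
-/

noncomputable section

/-!
## Part 1 — port of `Summits/ResolutionOfSingularities/ResolutionOfSingularities/Theorems/WeightedInvariantRegularSubschemeCentre.lean`

# Powers of the ideal of a regular closed subscheme form a regular weighted centre (all weights `1`)

Route `ResolutionOfSingularities/WeightedInvariant`, door crux `HypersurfaceCentreConstruction`
(stmt-ResolutionOfSingularities-19897: `∀ p prime, Nonempty (HypersurfaceTerminatingCentreDatum p)`), helper
for the admissibility clause `(iii-a)` of the datum (`ReesAlgebraData.IsRegularWeightedCentre`,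
Włodarczyk 2.1.10). Up to now the tree's only inhabitant of `IsRegularWeightedCentre` was the EMPTY centre
(`ReesAlgebraData.isRegularWeightedCentre_unit`). This file proves the first non-trivial one:

* `isRegularWeightedCentre_of_piece_eq_pow` — on a locally Noetherian scheme `Y` whose local
  rings are regular at the points of `V(J)`, if the closed subscheme `V(J)` of the ideal sheaf `J` is REGULAR,
  then every Rees algebra `R` with pieces `Rₙ = Jⁿ` (the Rees algebra `⊕ₙ Jⁿ tⁿ` of the ordinary blow-up of
  the regular centre `V(J)`) is a regular weighted centre: around every point there is an affine chart
  `(U, u, w ≡ 1)` with `Jⁿ(U) = (u)ⁿ = (u^α : Σ αᵢ ≥ n)` and the `uᵢ` part of a regular system of parameters at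
  every point of `V(u) ∩ U` (Włodarczyk 2.1.10 with all weights `aᵢ = 1`: "`uᵢ` are part of a system of
  parameters"; Lemma 4.6.1: the cobordant blow-up of `⊕ Jⁿ tⁿ` is the one at the centre `V(J)` with all
  weights `1`);
* `support_eq_of_piece_eq_pow` — its support is `V(J)`;
* `exists_isRegularWeightedCentre_support_eq` / `…_of_smooth` — packaged existence: every regular closed
  subscheme `Z` of a regular (resp. smooth over a field) `Y` is the support of a regular weighted centre
  (cf. the door's junk-datum screen «powers of `I_Z`, `Z` a regular stratum of `Sing V(X)`: ADMISSIBLE»).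

Ingredients (tree): local equations of a regular centre spread to an affine neighbourhood as ONE system that is
part of a regular system of parameters at EVERY point of the centre (`exists_affineOpen_forall_isRsopPart_germ`),
Matsumura 14.2 (1) ⇒ (2) (`mem_maximalIdeal_of_sum_mul_rsop_mem_sq`), stalks of quasi-coherent ideals as
localisations. Tools proved here: `weightedMonomialIdeal_one_eq_pow`, `ideal_le_of_forall_map_germ_le`,
`ideal_eq_top_of_forall_not_mem_support`. OURS (summit-side helper, `--supports stmt-…-19897`); no statement of
H. Hironaka's 2017 manuscript is typed or used. AI-written; weaker than expert review.

References: J. Włodarczyk, *Functorial resolution by torus actions*, arXiv:2203.03090, 2.1.10, Lemma 2.1.12,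
Lemma 4.6.1 [Wlodarczyk2022]; H. Matsumura, *Commutative Ring Theory*, CUP 1986, Thm. 14.2 [Matsumura1987].
-/

section Part1


open _root_.CategoryTheory _root_.AlgebraicGeometry _root_.TopologicalSpace _root_.IsLocalRing
open _root_.Literature.AlgebraicGeometry.Resolution

namespace Literature.AlgebraicGeometry.Resolution.WeightedInvariant

universe u

/-! ## §1 Algebra: unit-weight monomial ideals are the powers of `(u)` -/

section Algebra

variable {A : Type*} [CommRing A] {m : ℕ} (u : Fin m → A)

/-- The monomial ideals of a weighted chart are multiplicative: `𝒥_a · 𝒥_b ⊆ 𝒥_{a+b}`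
(`u^α · u^β = u^{α+β}`, weights add). [cite: Wlodarczyk2022, Lemma 2.1.12] -/
theorem weightedMonomialIdeal_mul_le (w : Fin m → ℕ) (a b : ℕ) :
    weightedMonomialIdeal u w a * weightedMonomialIdeal u w b ≤ weightedMonomialIdeal u w (a + b) := by
  unfold weightedMonomialIdeal
  rw [Ideal.span_mul_span', Ideal.span_le]
  rintro _ ⟨x, hx, y, hy, rfl⟩
  obtain ⟨α, hα, rfl⟩ := hx
  obtain ⟨β, hβ, rfl⟩ := hy
  refine Ideal.subset_span ⟨α + β, ?_, ?_⟩
  · have : ∑ i, w i * (α + β) i = ∑ i, w i * α i + ∑ i, w i * β i := by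
      simp only [Pi.add_apply, mul_add, Finset.sum_add_distrib]
    omega
  · simp only [Pi.add_apply, pow_add, Finset.prod_mul_distrib]

/-- **With all weights `1` the monomial ideals are the powers of the centre's ideal**:
`(u^α : Σ αᵢ ≥ n) = (u₁, …, uₘ)ⁿ` (Włodarczyk, Lemma 4.6.1: the Rees algebra `⊕ Jⁿ tⁿ` of an ideal is the
weighted one of the centre `V(J)` with all weights `1`). [cite: Wlodarczyk2022, Lemma 4.6.1] -/
theorem weightedMonomialIdeal_one_eq_pow (n : ℕ) :
    weightedMonomialIdeal u (fun _ => 1) n = Ideal.span (Set.range u) ^ n := by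
  apply le_antisymm
  · -- a generator `u^α` with `Σ αᵢ ≥ n` lies in `(u)^{Σ α} ⊆ (u)ⁿ`
    unfold weightedMonomialIdeal
    rw [Ideal.span_le]
    rintro x ⟨α, hα, rfl⟩
    simp only [one_mul] at hα
    have hmem : ∏ i, u i ^ α i ∈ Ideal.span (Set.range u) ^ (∑ i, α i) := by
      rw [← Finset.prod_pow_eq_pow_sum]
      exact Ideal.prod_mem_prod fun i _ => Ideal.pow_mem_pow (Ideal.subset_span (Set.mem_range_self i)) _
    exact Ideal.pow_le_pow_right hα hmem
  · -- `(u) ⊆ 𝒥₁` and `𝒥₁ⁿ ⊆ 𝒥ₙ`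
    have h1 : Ideal.span (Set.range u) ≤ weightedMonomialIdeal u (fun _ => 1) 1 := by
      rw [Ideal.span_le]
      rintro _ ⟨i, rfl⟩
      refine Ideal.subset_span ⟨Pi.single i 1, ?_, ?_⟩
      · rw [Finset.sum_eq_single i (fun j _ hj => by simp [hj])
          (fun hi => absurd (Finset.mem_univ i) hi)]
        simp
      · rw [Finset.prod_eq_single i (fun j _ hj => by simp [hj])
          (fun hi => absurd (Finset.mem_univ i) hi)]
        simp
    refine (Ideal.pow_right_mono h1 n).trans ?_
    induction n with
    | zero => rw [pow_zero, Ideal.one_eq_top, weightedMonomialIdeal_zero]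
    | succ n ih =>
      rw [pow_succ]
      exact (Ideal.mul_mono ih le_rfl).trans (weightedMonomialIdeal_mul_le u _ n 1)

end Algebra

/-! ## §2 Local algebra: a part of a regular system of parameters has linearly independent differentials -/

/-- **Matsumura 14.2, (1) ⇒ (2)**: if `z₁, …, z_n` is part of a regular system of parameters of the local
ring `R`, the images `dzᵢ ∈ 𝔪/𝔪²` are linearly independent over the residue field (extend to a minimal basis
of `𝔪` and use `mem_maximalIdeal_of_sum_mul_rsop_mem_sq`). [cite: Matsumura1987, Thm. 14.2] -/
theorem linearIndependent_toCotangent_of_isRsopPart {R : Type*} [CommRing R] [IsLocalRing R] {n : ℕ}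
    {z : Fin n → R} (hz : IsRsopPart z) (hmem : ∀ i, z i ∈ maximalIdeal R) :
    LinearIndependent (ResidueField R) (fun i => (maximalIdeal R).toCotangent ⟨z i, hmem i⟩) := by
  haveI := hz.isRegularLocalRing
  rw [linearIndependent_toCotangent_iff_forall_mem]
  intro c hc i
  obtain ⟨e, x, hd, hx, hxz⟩ := hz.exists_rsop
  let c' : Fin (n + e) → R := Fin.append c 0
  have hsum : ∑ k, c' k * x k = ∑ i, c i * z i := by
    rw [Fin.sum_univ_add]
    simp [c', hxz]
  have h := mem_maximalIdeal_of_sum_mul_rsop_mem_sq hd x hx c' (by rw [hsum]; exact hc)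
    (Fin.castAdd e i)
  simpa [c'] using h

/-! ## §3 Affine bookkeeping: ideals of `Γ(Y, U)` read on the stalks at the points of `U` -/

section Affine

variable {Y : Scheme.{u}}

/-- **An inclusion of ideals of `Γ(Y, U)`, `U` affine, can be checked on the stalks `𝒪_{Y,y}`, `y ∈ U`**
(they are the localisations of `Γ(Y, U)` at its primes). [folklore] -/
private theorem ideal_le_of_forall_map_germ_le (U : Y.affineOpens) {I₁ I₂ : Ideal Γ(Y, U)}
    (h : ∀ (y : Y) (hy : y ∈ (U : Y.Opens)),
      I₁.map (Y.presheaf.germ U y hy).hom ≤ I₂.map (Y.presheaf.germ U y hy).hom) :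
    I₁ ≤ I₂ := by
  refine Ideal.le_of_localization_maximal fun P hP => ?_
  haveI := hP.isPrime
  let q : PrimeSpectrum Γ(Y, U) := ⟨P, hP.isPrime⟩
  have hy : U.2.fromSpec q ∈ (U : Y.Opens) := U.2.range_fromSpec.le ⟨q, rfl⟩
  letI : Algebra Γ(Y, U) (Y.presheaf.stalk (U.2.fromSpec q)) :=
    (Y.presheaf.germ U (U.2.fromSpec q) hy).hom.toAlgebra
  haveI : IsLocalization.AtPrime (Y.presheaf.stalk (U.2.fromSpec q)) P :=
    U.2.isLocalization_stalk' q hy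
  let e : Localization.AtPrime P ≃ₐ[Γ(Y, U)] Y.presheaf.stalk (U.2.fromSpec q) :=
    IsLocalization.algEquiv P.primeCompl _ _
  have key := h (U.2.fromSpec q) hy
  have key' := Ideal.map_mono (f := e.symm.toAlgHom.toRingHom) key
  rw [Ideal.map_map, Ideal.map_map] at key'
  have hcomp : e.symm.toAlgHom.toRingHom.comp (Y.presheaf.germ U (U.2.fromSpec q) hy).hom =
      algebraMap Γ(Y, U) (Localization.AtPrime P) :=
    RingHom.ext fun a => e.symm.commutes a
  rwa [hcomp] at key'

/-- Equality of ideals of `Γ(Y, U)` from equality of their images in all stalks. [folklore] -/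
private theorem ideal_eq_of_forall_map_germ_eq (U : Y.affineOpens) {I₁ I₂ : Ideal Γ(Y, U)}
    (h : ∀ (y : Y) (hy : y ∈ (U : Y.Opens)),
      I₁.map (Y.presheaf.germ U y hy).hom = I₂.map (Y.presheaf.germ U y hy).hom) :
    I₁ = I₂ :=
  le_antisymm (ideal_le_of_forall_map_germ_le U fun y hy => (h y hy).le)
    (ideal_le_of_forall_map_germ_le U fun y hy => (h y hy).ge)

/-- **Off the support an ideal sheaf has unit sections**: if no point of the affine open `U` lies in
`Supp(𝒪/J)` then `J(U) = Γ(Y, U)` (a proper `J(U)` lies in a maximal ideal, whose point of `U` would be in the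
support). [folklore] -/
private theorem ideal_eq_top_of_forall_not_mem_support (J : Y.IdealSheafData) (U : Y.affineOpens)
    (hU : ∀ y ∈ (U : Y.Opens), y ∉ J.support) : J.ideal U = ⊤ := by
  by_contra hne
  obtain ⟨P, hP, hle⟩ := Ideal.exists_le_maximal _ hne
  let q : PrimeSpectrum Γ(Y, U) := ⟨P, hP.isPrime⟩
  have hy : U.2.fromSpec q ∈ (U : Y.Opens) := U.2.range_fromSpec.le ⟨q, rfl⟩
  refine hU _ hy ((Scheme.IdealSheafData.mem_support_iff_of_mem hy).mpr ?_)
  have hq : q ∈ U.2.fromSpec ⁻¹' Y.zeroLocus (U := U) (J.ideal U : Set Γ(Y, U)) := by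
    rw [U.2.fromSpec_preimage_zeroLocus]; exact hle
  exact hq

end Affine

/-! ## §4 The theorem -/

/-- In a Noetherian ring: if every element of the ideal `I` is multiplied into `J` by SOME element outside the
prime `p`, then ONE `g ∉ p` does it for all of `I`. [folklore] -/
private theorem exists_not_mem_forall_mul_mem {A : Type*} [CommRing A] [IsNoetherianRing A]
    (I J p : Ideal A) [p.IsPrime] (h : ∀ x ∈ I, ∃ s ∉ p, s * x ∈ J) :
    ∃ g ∉ p, ∀ x ∈ I, g * x ∈ J := by
  classical
  obtain ⟨T, hT⟩ := (IsNoetherian.noetherian I : I.FG)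
  choose! s hs using h
  refine ⟨∏ t ∈ T, s t, ?_, ?_⟩
  · have hmem : (∏ t ∈ T, s t) ∈ p.primeCompl :=
      prod_mem fun t htT => show s t ∈ p.primeCompl from (hs t (hT ▸ Ideal.subset_span htT)).1
    exact hmem
  · intro x hx
    rw [← hT] at hx
    refine Submodule.span_induction (p := fun x _ => (∏ t ∈ T, s t) * x ∈ J) ?_ ?_ ?_ ?_ hx
    · intro t htT
      obtain ⟨w, hw⟩ : s t ∣ ∏ t' ∈ T, s t' := Finset.dvd_prod_of_mem s htT
      rw [hw, mul_comm (s t) w, mul_assoc]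
      exact Ideal.mul_mem_left _ _ (hs t (hT ▸ Ideal.subset_span htT)).2
    · simp
    · intro x y _ _ hx hy
      rw [mul_add]
      exact add_mem hx hy
    · intro a x _ hx
      rw [smul_eq_mul, mul_left_comm]
      exact Ideal.mul_mem_left _ _ hx

/-- **Powers of the ideal of a regular closed subscheme form a regular weighted centre, all weights `1`**
(Włodarczyk 2.1.10 / Lemma 4.6.1). Let `Y` be locally Noetherian with regular local rings at the points of
`V(J)`, and let the closed subscheme `V(J)` of the ideal sheaf `J` be regular. Then a Rees algebra `R` on `Y`
with pieces `Rₙ = Jⁿ` is a regular weighted centre: every point has an affine chart `(U, u₁…u_r, w ≡ 1)` with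
`Jⁿ(U) = (u^α : Σ αᵢ ≥ n)` and `u` part of a regular system of parameters of `𝒪_{Y,y'}` at every point `y'` of
`U` where all `uᵢ` vanish. Off `V(J)` the chart is the unit one; at a point of `V(J)` it is the system of
local equations of the regular centre spread to an affine neighbourhood
(`exists_affineOpen_forall_isRsopPart_germ`), shrunk to a basic open on which these equations generate `J`.
[cite: Wlodarczyk2022, 2.1.10 and Lemma 4.6.1] -/
theorem isRegularWeightedCentre_of_piece_eq_pow {Y : Scheme.{u}} [IsLocallyNoetherian Y]
    (J : Y.IdealSheafData) (hJ : Scheme.IsRegular J.subscheme)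
    (hY : ∀ y ∈ J.support, IsRegularLocalRing (Y.presheaf.stalk y))
    (R : ReesAlgebraData Y) (hR : ∀ n, R.piece n = J ^ n) :
    R.IsRegularWeightedCentre := by
  classical
  intro y
  by_cases hyC : y ∈ J.support
  swap
  · /- off the centre: the unit chart on an affine neighbourhood missing `V(J)` -/
    have hyO : y ∈ (J.support : Closeds Y).compl := hyC
    obtain ⟨U', hU', hyU, hsub⟩ := exists_isAffineOpen_mem_and_subset (X := Y) (x := y) hyO
    have htop : J.ideal ⟨U', hU'⟩ = ⊤ :=
      ideal_eq_top_of_forall_not_mem_support J ⟨U', hU'⟩ fun z hz hzC => hsub hz hzC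
    refine ⟨⟨U', hU'⟩, hyU, 1, fun _ => 1, fun _ => 1, ⟨fun _ => Nat.one_pos, fun n => ?_, ?_⟩⟩
    · rw [hR, Scheme.IdealSheafData.ideal_pow, Pi.pow_apply, htop, ReesAlgebraData.weightedMonomialIdeal_one,
        Ideal.top_pow]
    · intro y' hy' h
      have h0 := h 0
      rw [map_one] at h0
      exact absurd (Ideal.eq_top_of_isUnit_mem _ h0 isUnit_one) (maximalIdeal.isMaximal _).ne_top
  /- at a point of the centre -/
  have hJv : J = Scheme.IdealSheafData.vanishingIdeal J.support :=
    eq_vanishingIdeal_support_of_isRegular J hJ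
  have hreg : Scheme.IsRegular (Scheme.IdealSheafData.vanishingIdeal J.support).subscheme := hJv ▸ hJ
  obtain ⟨V, hyV, r, g, hg⟩ := exists_affineOpen_forall_isRsopPart_germ J.support hreg hY hyC
  simp_rw [← hJv] at hg
  haveI : IsNoetherianRing Γ(Y, V) := IsLocallyNoetherian.component_noetherian V
  -- `𝒪_{Y,y} = Γ(Y, V)_𝔭`
  let xy : (V : Y.Opens) := ⟨y, hyV⟩
  letI algy : Algebra Γ(Y, V) (Y.presheaf.stalk y) := TopCat.Presheaf.algebra_section_stalk Y.presheaf xy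
  haveI hlocy : IsLocalization.AtPrime (Y.presheaf.stalk y) (V.2.primeIdealOf xy).asIdeal :=
    V.2.isLocalization_stalk xy
  set P := (V.2.primeIdealOf xy).asIdeal with hP
  have halgy : ∀ f : Γ(Y, V), algebraMap Γ(Y, V) (Y.presheaf.stalk y) f = (Y.presheaf.germ V y hyV).hom f := fun _ => rfl
  set I : Ideal Γ(Y, V) := J.ideal V with hI
  set I' : Ideal Γ(Y, V) := Ideal.span (Set.range g) with hI'
  -- at `y` the two ideals have the same stalk
  have hIy : I.map (algebraMap Γ(Y, V) (Y.presheaf.stalk y)) = I'.map (algebraMap Γ(Y, V) (Y.presheaf.stalk y)) := by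
    have h2 := (hg y hyV hyC).2
    rw [stalkIdeal_eq_map_germ J V hyV] at h2
    rw [hI', Ideal.map_span, ← Set.range_comp]
    exact h2.symm
  -- one multiplier `s ∉ 𝔭` with `s · I ⊆ I'`
  have hmul : ∀ x ∈ I, ∃ s ∉ P, s * x ∈ I' := fun x hx => by
    have hx' : algebraMap Γ(Y, V) (Y.presheaf.stalk y) x ∈ I'.map (algebraMap Γ(Y, V) (Y.presheaf.stalk y)) :=
      hIy ▸ Ideal.mem_map_of_mem _ hx
    exact (IsLocalization.algebraMap_mem_map_algebraMap_iff P.primeCompl _ I' x).mp hx'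
  obtain ⟨s, hsP, hs⟩ := exists_not_mem_forall_mul_mem I I' P hmul
  -- the chart `U = D(s) ∋ y`
  have hys : y ∈ Y.basicOpen s := by
    rw [Scheme.mem_basicOpen _ _ _ hyV, ← halgy]
    exact (IsLocalization.AtPrime.isUnit_to_map_iff (Y.presheaf.stalk y) P s).mpr hsP
  let U : Y.affineOpens := Y.affineBasicOpen s
  have hUV : (U : Y.Opens) ≤ V := Y.basicOpen_le s
  let ρ : Γ(Y, V) →+* Γ(Y, U) := (Y.presheaf.map (homOfLE hUV).op).hom
  -- germs of restrictions
  have hgerm : ∀ (η : Y) (hη : η ∈ (U : Y.Opens)) (f : Γ(Y, V)),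
      (Y.presheaf.germ (U : Y.Opens) η hη).hom (ρ f) = (Y.presheaf.germ V η (hUV hη)).hom f :=
    fun η hη f => TopCat.Presheaf.germ_res_apply Y.presheaf (homOfLE hUV) η hη f
  -- KEY: a point of `U` where all `g_j` vanish lies on the centre
  have key : ∀ (η : Y) (hη : η ∈ (U : Y.Opens)),
      (∀ j, (Y.presheaf.germ V η (hUV hη)).hom (g j) ∈ maximalIdeal (Y.presheaf.stalk η)) → η ∈ J.support := by
    intro η hη hm
    by_contra hηC
    have htop : I.map (Y.presheaf.germ V η (hUV hη)).hom = ⊤ := by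
      rw [hI, ← stalkIdeal_eq_map_germ J V (hUV hη)]
      exact stalkIdeal_eq_top_of_not_mem_support hηC
    have hsu : IsUnit ((Y.presheaf.germ V η (hUV hη)).hom s) := (Scheme.mem_basicOpen _ _ _ (hUV hη)).mp hη
    have hle : I.map (Y.presheaf.germ V η (hUV hη)).hom ≤ I'.map (Y.presheaf.germ V η (hUV hη)).hom := by
      rw [Ideal.map_le_iff_le_comap]
      intro x hx
      obtain ⟨w, hw⟩ := hsu
      have h1 : (Y.presheaf.germ V η (hUV hη)).hom (s * x) ∈ I'.map (Y.presheaf.germ V η (hUV hη)).hom :=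
        Ideal.mem_map_of_mem _ (hs x hx)
      rw [map_mul, ← hw] at h1
      have h2 : (Y.presheaf.germ V η (hUV hη)).hom x = ↑w⁻¹ * (↑w * (Y.presheaf.germ V η (hUV hη)).hom x) := by
        rw [← mul_assoc, Units.inv_mul, one_mul]
      rw [Ideal.mem_comap, h2]
      exact Ideal.mul_mem_left _ _ h1
    have hle' : I'.map (Y.presheaf.germ V η (hUV hη)).hom ≤ maximalIdeal (Y.presheaf.stalk η) := by
      rw [hI', Ideal.map_span, Ideal.span_le]
      rintro _ ⟨_, ⟨j, rfl⟩, rfl⟩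
      exact hm j
    exact (maximalIdeal.isMaximal (Y.presheaf.stalk η)).ne_top (top_le_iff.mp (htop ▸ hle.trans hle'))
  -- the stalks of `J` on `U` are generated by the germs of `g`
  have hstalk : ∀ (η : Y) (hη : η ∈ (U : Y.Opens)),
      stalkIdeal J η = Ideal.span (Set.range fun j => (Y.presheaf.germ V η (hUV hη)).hom (g j)) := by
    intro η hη
    by_cases hηC : η ∈ J.support
    · exact ((hg η (hUV hη) hηC).2).symm
    · rw [stalkIdeal_eq_top_of_not_mem_support hηC]
      symm
      by_contra hne
      refine hηC (key η hη fun j => ?_)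
      have hj : (Y.presheaf.germ V η (hUV hη)).hom (g j) ∈
          Ideal.span (Set.range fun j => (Y.presheaf.germ V η (hUV hη)).hom (g j)) :=
        Ideal.subset_span (Set.mem_range_self j)
      exact le_maximalIdeal hne hj
  -- hence `J(U) = (g|_U)`
  have hJU : J.ideal U = Ideal.span (Set.range fun j => ρ (g j)) := by
    refine ideal_eq_of_forall_map_germ_eq U fun η hη => ?_
    have hcomp : ((Y.presheaf.germ (U : Y.Opens) η hη).hom ∘ fun j => ρ (g j)) =
        fun j => (Y.presheaf.germ V η (hUV hη)).hom (g j) :=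
      funext fun j => hgerm η hη (g j)
    rw [← stalkIdeal_eq_map_germ J U hη, hstalk η hη, Ideal.map_span, ← Set.range_comp, hcomp]
  refine ⟨U, hys, r, fun j => ρ (g j), fun _ => 1, ⟨fun _ => Nat.one_pos, fun n => ?_, ?_⟩⟩
  · -- the pieces: `Jⁿ(U) = (g)ⁿ = (g^α : Σ α ≥ n)`
    rw [hR, Scheme.IdealSheafData.ideal_pow, Pi.pow_apply, hJU, weightedMonomialIdeal_one_eq_pow]
  · -- linear independence at the points of `V(g) ∩ U ⊆ V(J)`
    intro y' hy' hm
    have hm' : ∀ j, (Y.presheaf.germ V y' (hUV hy')).hom (g j) ∈ maximalIdeal (Y.presheaf.stalk y') :=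
      fun j => hgerm y' hy' (g j) ▸ hm j
    have hy'C : y' ∈ J.support := key y' hy' hm'
    have hli := linearIndependent_toCotangent_of_isRsopPart (hg y' (hUV hy') hy'C).1 hm'
    have hfun : (fun j => (maximalIdeal (Y.presheaf.stalk y')).toCotangent ⟨_, hm j⟩) =
        fun j => (maximalIdeal (Y.presheaf.stalk y')).toCotangent ⟨_, hm' j⟩ :=
      funext fun j => congrArg _ (Subtype.ext (hgerm y' hy' (g j)))
    rw [hfun]
    exact hli

/-- The support of a Rees algebra with pieces `Jⁿ` is `V(J)`. [folklore] -/
private theorem support_eq_of_piece_eq_pow {Y : Scheme.{u}} (J : Y.IdealSheafData)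
    (R : ReesAlgebraData Y) (hR : ∀ n, R.piece n = J ^ n) : R.support = (J.support : Set Y) := by
  ext y
  rw [R.mem_support_iff]
  constructor
  · intro h
    have h1 := h 1 Nat.one_pos
    rwa [hR, pow_one] at h1
  · intro hy n hn
    rwa [hR, Scheme.IdealSheafData.support_pow _ n hn.ne']

/-- **On a regular scheme the pieces `Jⁿ` of a regular centre `V(J)` form a regular weighted centre**
(the case `Scheme.IsRegular Y` of `isRegularWeightedCentre_of_piece_eq_pow`; the name is the one under which the
door's designer memo asked for this helper). [cite: Wlodarczyk2022, 2.1.10] -/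
theorem isRegularWeightedCentre_powers_of_isRegular {Y : Scheme.{u}}
    [IsLocallyNoetherian Y] (hY : Scheme.IsRegular Y) (J : Y.IdealSheafData)
    (hJ : Scheme.IsRegular J.subscheme) (R : ReesAlgebraData Y) (hR : ∀ n, R.piece n = J ^ n) :
    R.IsRegularWeightedCentre :=
  isRegularWeightedCentre_of_piece_eq_pow J hJ (fun y _ => hY y) R hR

/-- **Regular weighted centres with prescribed regular support exist**: on a regular locally Noetherian
scheme `Y`, every ideal sheaf `J` with regular closed subscheme `V(J)` is carried by a regular weighted centre
— the Rees algebra of its powers — with support `V(J)`. (Non-vacuity of the door's clause `(iii-a)` beyond the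
empty centre `isRegularWeightedCentre_unit`.) [cite: Wlodarczyk2022, 2.1.10 and Lemma 4.6.1] -/
theorem exists_isRegularWeightedCentre_support_eq {Y : Scheme.{u}} [IsLocallyNoetherian Y]
    (hY : Scheme.IsRegular Y) (J : Y.IdealSheafData) (hJ : Scheme.IsRegular J.subscheme) :
    ∃ R : ReesAlgebraData Y, R.IsRegularWeightedCentre ∧ R.support = (J.support : Set Y) ∧
      ∀ n, R.piece n = J ^ n := by
  let R : ReesAlgebraData Y :=
    { piece := fun n => J ^ n
      piece_zero := by rw [pow_zero]; rfl
      piece_mul_le := fun m n => by rw [← pow_add] }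
  exact ⟨R, isRegularWeightedCentre_powers_of_isRegular hY J hJ R (fun _ => rfl),
    support_eq_of_piece_eq_pow J R (fun _ => rfl), fun _ => rfl⟩

/-- `Spec` of a field is a regular scheme (its only local ring is the field). [folklore] -/
private theorem isRegular_Spec_field (k : Type u) [Field k] : Scheme.IsRegular (Spec (.of k)) := by
  apply Scheme.IsRegular.of_topologicalKrullDim_le_zero
  show topologicalKrullDim (PrimeSpectrum k) ≤ 0
  rw [PrimeSpectrum.topologicalKrullDim_eq_ringKrullDim, ringKrullDim_eq_zero_of_field]

/-- **The door's setting**: on a smooth scheme `f : Y → Spec k` over a field (hence regular and locally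
Noetherian), every regular closed subscheme `V(J)` is the support of a regular weighted centre with pieces
`Jⁿ` — e.g. a regular stratum of the singular locus of a hypersurface, the `(iii-a)`/`(iii-b′)`-admissible
centre of the junk-datum screen of crux `HypersurfaceCentreConstruction`. [cite: Wlodarczyk2022, 2.1.10] -/
theorem exists_isRegularWeightedCentre_support_eq_of_smooth {k : Type u} [Field k] {Y : Scheme.{u}}
    (f : Y ⟶ Spec (.of k)) [Smooth f] (J : Y.IdealSheafData) (hJ : Scheme.IsRegular J.subscheme) :
    ∃ R : ReesAlgebraData Y, R.IsRegularWeightedCentre ∧ R.support = (J.support : Set Y) ∧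
      ∀ n, R.piece n = J ^ n := by
  haveI : IsLocallyNoetherian Y := LocallyOfFiniteType.isLocallyNoetherian f
  have hY : Scheme.IsRegular Y := Scheme.IsRegular.of_smooth f (isRegular_Spec_field k)
  exact exists_isRegularWeightedCentre_support_eq hY J hJ

end Literature.AlgebraicGeometry.Resolution.WeightedInvariant

end Part1

/-!
## Part 2 — port of `Summits/ResolutionOfSingularities/ResolutionOfSingularities/Theorems/WeightedInvariantHypersurfaceCentreAlgebraize.lean`

# Door H2b (ALGEBRAIZE) — formal point moves are algebraic (jets), and a move at ONE point is a weighted chart NEAR it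

Route `ResolutionOfSingularities/WeightedInvariant`, crux `Theses.WeightedInvariant.HypersurfaceCentreConstruction`
(stmt-ResolutionOfSingularities-19897), door line `local-engine`, CRUX-PLAN §v6.2 H2b «Algebraize» of
`res-L1-w43-plan-1` (seat res-L1-w43-stub-9 = res-D-brk-1 converted): the filtration
`weightedMonomialIdeal u w` (`(u^α : Σ wᵢ αᵢ ≥ n)`, Włodarczyk Lemma 2.1.12) is MULTIPLICATIVE and each
parameter `uᵢ` lies in its own piece of degree `wᵢ`; consequently the filtration does not change when every
`uᵢ` is perturbed inside the piece of degree `wᵢ` — in a local ring with all weights `≥ 1` and `u`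
generating `𝔪`, any `v ≡ u (mod 𝔪^N)`, `N ≥ max wᵢ`, defines the SAME weighted filtration («point moves
depend only on `(max w)`-jets»: a formal point move of the local weighted game is already algebraic).
Second part (A2, door-shaped): on a scheme locally of finite type over a PERFECT field, sections `u₁, …, u_m`
that are part of a regular system of parameters at ONE point `y` (regular local ring) and any positive weights
give a WEIGHTED CHART (`ReesAlgebraData.IsWeightedChart`, Włodarczyk 2.1.10) on an affine neighbourhood of `y`
for every Rees algebra whose pieces there are the weighted monomial ideals of the `uᵢ` — the independence of
the differentials spreads to all points of `V(u)` near `y` (`Resolution.CotangentIndependenceSpread`: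
openness of the regular loci of the quotients `𝒪/(uᵢ : i ∈ T)` over a perfect field, Matsumura 14.2 in its
minimal form). Def-free helper lemmas (`--supports stmt-ResolutionOfSingularities-19897`); nothing here is a
claim about Hironaka's problem, and no regular weighted centre is asserted to exist unconditionally.
-/

section Part2


namespace Literature.AlgebraicGeometry.Resolution.WeightedInvariant

open _root_.CategoryTheory _root_.AlgebraicGeometry _root_.TopologicalSpace _root_.IsLocalRing
open _root_.Literature.AlgebraicGeometry.Resolution

/-! ## A1. Weighted monomial filtrations depend only on jets -/

section Jets

variable {A : Type*} [CommRing A] {m : ℕ}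

/-- A monomial `u^α` of weighted degree `Σ wᵢ αᵢ ≥ n` lies in the piece of degree `n`. [folklore] -/
private theorem prod_pow_mem_weightedMonomialIdeal (u : Fin m → A) (w : Fin m → ℕ) {n : ℕ} (α : Fin m → ℕ)
    (hα : n ≤ ∑ i, w i * α i) : ∏ i, u i ^ α i ∈ weightedMonomialIdeal u w n :=
  Ideal.subset_span ⟨α, hα, rfl⟩

/-- Each parameter `uᵢ` lies in the piece of degree `wᵢ` (the monomial with `α = eᵢ`).
[cite: Wlodarczyk2022, Lemma 2.1.12] -/
theorem self_mem_weightedMonomialIdeal (u : Fin m → A) (w : Fin m → ℕ) (i : Fin m) :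
    u i ∈ weightedMonomialIdeal u w (w i) := by
  have h := prod_pow_mem_weightedMonomialIdeal u w (n := w i) (Pi.single i 1) (by
    rw [Finset.sum_eq_single i (fun j _ hj => by simp [hj]) (fun hi => absurd (Finset.mem_univ i) hi)]
    simp)
  rwa [Finset.prod_eq_single i (fun j _ hj => by simp [hj]) (fun hi => absurd (Finset.mem_univ i) hi),
    Pi.single_eq_same, pow_one] at h

/-- Powers: `x ∈ I_a ⇒ x^k ∈ I_{k·a}`. [folklore] -/
private theorem pow_mem_weightedMonomialIdeal (u : Fin m → A) (w : Fin m → ℕ) {a : ℕ} {x : A}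
    (hx : x ∈ weightedMonomialIdeal u w a) (k : ℕ) : x ^ k ∈ weightedMonomialIdeal u w (a * k) := by
  induction k with
  | zero => rw [pow_zero, Nat.mul_zero, weightedMonomialIdeal_zero]; exact Submodule.mem_top
  | succ k ih =>
    rw [pow_succ, Nat.mul_succ]
    exact weightedMonomialIdeal_mul_le u w _ _ (Ideal.mul_mem_mul ih hx)

/-- Weighted products: if `xᵢ ∈ I_{wᵢ}` for all `i` then `∏ xᵢ^{αᵢ} ∈ I_{Σ wᵢ αᵢ}`. [folklore] -/
private theorem prod_pow_mem_weightedMonomialIdeal_of_mem (u : Fin m → A) (w : Fin m → ℕ) {x : Fin m → A}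
    (hx : ∀ i, x i ∈ weightedMonomialIdeal u w (w i)) (α : Fin m → ℕ) :
    ∏ i, x i ^ α i ∈ weightedMonomialIdeal u w (∑ i, w i * α i) := by
  classical
  induction (Finset.univ : Finset (Fin m)) using Finset.induction_on with
  | empty => rw [Finset.prod_empty, Finset.sum_empty, weightedMonomialIdeal_zero]; exact Submodule.mem_top
  | insert i s hi ih =>
    rw [Finset.prod_insert hi, Finset.sum_insert hi, Nat.add_comm]
    exact weightedMonomialIdeal_mul_le u w _ _
      (Ideal.mul_mem_mul (by simpa [Nat.mul_comm] using ih) (pow_mem_weightedMonomialIdeal u w (hx i) (α i)))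
      |> fun h => by simpa [Nat.add_comm, Nat.mul_comm, mul_comm] using h

/-- **Jets lemma (one inclusion).** If every `vᵢ` lies in the degree-`wᵢ` piece of the weighted filtration of
`u` — in particular if `vᵢ − uᵢ ∈ I_{wᵢ}(u)` — then the whole weighted filtration of `v` is contained in
that of `u`: `I_n(v) ⊆ I_n(u)` for every `n`. [cite: Wlodarczyk2022, Lemma 2.1.12] -/
theorem weightedMonomialIdeal_le_of_forall_mem (u v : Fin m → A) (w : Fin m → ℕ)
    (hv : ∀ i, v i ∈ weightedMonomialIdeal u w (w i)) (n : ℕ) :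
    weightedMonomialIdeal v w n ≤ weightedMonomialIdeal u w n := by
  rw [weightedMonomialIdeal, Ideal.span_le]
  rintro _ ⟨α, hα, rfl⟩
  exact weightedMonomialIdeal_antitone u w hα (prod_pow_mem_weightedMonomialIdeal_of_mem u w hv α)

/-- **Jets lemma (perturbation form).** If `vᵢ − uᵢ ∈ I_{wᵢ}(u)` for all `i`, then `I_n(v) ⊆ I_n(u)` for
all `n`. [cite: Wlodarczyk2022, Lemma 2.1.12] -/
theorem weightedMonomialIdeal_le_of_forall_sub_mem (u v : Fin m → A) (w : Fin m → ℕ)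
    (hv : ∀ i, v i - u i ∈ weightedMonomialIdeal u w (w i)) (n : ℕ) :
    weightedMonomialIdeal v w n ≤ weightedMonomialIdeal u w n :=
  weightedMonomialIdeal_le_of_forall_mem u v w
    (fun i => by simpa using Ideal.add_mem _ (hv i) (self_mem_weightedMonomialIdeal u w i)) n

/-- **Jets lemma (equality).** If `vᵢ − uᵢ ∈ I_{wᵢ}(u)` and `uᵢ − vᵢ ∈ I_{wᵢ}(v)` for all `i`, the two
weighted filtrations coincide. [cite: Wlodarczyk2022, Lemma 2.1.12] -/
theorem weightedMonomialIdeal_eq_of_forall_sub_mem (u v : Fin m → A) (w : Fin m → ℕ)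
    (hv : ∀ i, v i - u i ∈ weightedMonomialIdeal u w (w i))
    (hu : ∀ i, u i - v i ∈ weightedMonomialIdeal v w (w i)) (n : ℕ) :
    weightedMonomialIdeal v w n = weightedMonomialIdeal u w n :=
  le_antisymm (weightedMonomialIdeal_le_of_forall_sub_mem u v w hv n)
    (weightedMonomialIdeal_le_of_forall_sub_mem v u w hu n)

/-- If `u` generates the ideal `M` and all weights are `≥ 1`, then `M^n ⊆ I_n(u)` for every `n`
(each generator has weighted degree `≥ 1`). [cite: Wlodarczyk2022, Lemma 2.1.12] -/
theorem pow_le_weightedMonomialIdeal_of_span_eq (u : Fin m → A) (w : Fin m → ℕ) (hw : ∀ i, 0 < w i)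
    {M : Ideal A} (hM : Ideal.span (Set.range u) = M) (n : ℕ) : M ^ n ≤ weightedMonomialIdeal u w n := by
  have h1 : M ≤ weightedMonomialIdeal u w 1 := by
    rw [← hM, Ideal.span_le]
    rintro _ ⟨i, rfl⟩
    exact weightedMonomialIdeal_antitone u w (hw i) (self_mem_weightedMonomialIdeal u w i)
  induction n with
  | zero => rw [pow_zero, Ideal.one_eq_top, weightedMonomialIdeal_zero]
  | succ n ih =>
    rw [pow_succ]
    exact (Ideal.mul_mono ih h1).trans (weightedMonomialIdeal_mul_le u w n 1)

/-- **Point moves depend only on jets.** Let `u` and `v` both generate the ideal `M` (e.g. two systems of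
parameters of a local ring generating its maximal ideal), all weights `wᵢ ≥ 1`, `N ≥ wᵢ` for all `i`, and
`vᵢ ≡ uᵢ (mod M^N)`. Then `v` defines the same weighted filtration as `u`: `I_n(v) = I_n(u)` for all `n`.
(«point centres algebraize»: a weighted point move of the formal game read through any `(max w)`-jet of its
parameters is the same move.) [cite: Wlodarczyk2022, Lemma 2.1.12] -/
theorem weightedMonomialIdeal_eq_of_sub_mem_pow (u v : Fin m → A) (w : Fin m → ℕ) (hw : ∀ i, 0 < w i)
    {M : Ideal A} (hMu : Ideal.span (Set.range u) = M) (hMv : Ideal.span (Set.range v) = M) {N : ℕ}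
    (hN : ∀ i, w i ≤ N) (hv : ∀ i, v i - u i ∈ M ^ N) (n : ℕ) :
    weightedMonomialIdeal v w n = weightedMonomialIdeal u w n := by
  refine weightedMonomialIdeal_eq_of_forall_sub_mem u v w (fun i => ?_) (fun i => ?_) n
  · exact pow_le_weightedMonomialIdeal_of_span_eq u w hw hMu (w i) (Ideal.pow_le_pow_right (hN i) (hv i))
  · refine pow_le_weightedMonomialIdeal_of_span_eq v w hw hMv (w i) (Ideal.pow_le_pow_right (hN i) ?_)
    rw [← neg_sub]
    exact neg_mem (hv i)

/-- **Nakayama bookkeeping for perturbed generators**: if `u` generates a finitely generated ideal `M`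
contained in the Jacobson radical (e.g. the maximal ideal of a local ring) and `vᵢ ≡ uᵢ (mod M²)`, then `v`
generates `M` as well. [folklore] -/
private theorem span_eq_of_sub_mem_sq (u v : Fin m → A) {M : Ideal A} (hMu : Ideal.span (Set.range u) = M)
    (hMjac : M ≤ Ideal.jacobson ⊥) (hv : ∀ i, v i - u i ∈ M ^ 2) : Ideal.span (Set.range v) = M := by
  have hfg : M.FG := by
    rw [← hMu]
    exact Submodule.fg_def.mpr ⟨Set.range u, Set.finite_range u, rfl⟩
  apply le_antisymm
  · rw [Ideal.span_le]
    rintro _ ⟨i, rfl⟩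
    have hu : u i ∈ M := hMu ▸ Ideal.subset_span ⟨i, rfl⟩
    have h2 : v i - u i ∈ M := Ideal.pow_le_self two_ne_zero (hv i)
    simpa using M.add_mem h2 hu
  · -- `M ≤ span v ⊔ M • M`, then Nakayama
    refine Submodule.le_of_le_smul_of_le_jacobson_bot hfg hMjac ?_
    rw [← hMu, Ideal.span_le]
    rintro _ ⟨i, rfl⟩
    have hdec : u i = v i - (v i - u i) := by ring
    rw [hdec]
    refine Ideal.sub_mem _ (Ideal.mem_sup_left (Ideal.subset_span ⟨i, rfl⟩)) (Ideal.mem_sup_right ?_)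
    rw [Ideal.smul_eq_mul, ← pow_two, hMu]
    exact hv i

/-- **Point moves depend only on jets, local-ring form.** In a local ring, let `u` generate the maximal ideal
`𝔪`, all weights `wᵢ ≥ 1`, and `N ≥ max(2, wᵢ)`; then every `v` with `vᵢ ≡ uᵢ (mod 𝔪^N)` again generates
`𝔪` and defines the same weighted filtration `I_n(v) = I_n(u)`. [cite: Wlodarczyk2022, Lemma 2.1.12] -/
theorem weightedMonomialIdeal_eq_of_sub_mem_maximalIdeal_pow [IsLocalRing A] (u v : Fin m → A)
    (w : Fin m → ℕ) (hw : ∀ i, 0 < w i) (hMu : Ideal.span (Set.range u) = IsLocalRing.maximalIdeal A)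
    {N : ℕ} (hN2 : 2 ≤ N) (hN : ∀ i, w i ≤ N) (hv : ∀ i, v i - u i ∈ IsLocalRing.maximalIdeal A ^ N) :
    Ideal.span (Set.range v) = IsLocalRing.maximalIdeal A ∧
      ∀ n, weightedMonomialIdeal v w n = weightedMonomialIdeal u w n := by
  have hMv : Ideal.span (Set.range v) = IsLocalRing.maximalIdeal A :=
    span_eq_of_sub_mem_sq u v hMu (IsLocalRing.maximalIdeal_le_jacobson ⊥)
      (fun i => Ideal.pow_le_pow_right hN2 (hv i))
  exact ⟨hMv, fun n => weightedMonomialIdeal_eq_of_sub_mem_pow u v w hw hMu hMv hN hv n⟩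

end Jets

/-! ## A2. A move at one point is a weighted chart on a neighbourhood -/

section Chart

universe u

/-- **ALGEBRAIZE, chart form.** Let `Y` be locally of finite type over a perfect field `k`, `U ⊆ Y` an affine
open, `y ∈ U` _root_.a _root_.point _root_.with `𝒪_{Y,y}` regular, `u₁, …, _root_.u_m ∈ Γ(Y, U)` _root_.vanishing _root_.at `y` _root_.with _root_.linearly _root_.independent
classes in `𝔪_y/𝔪_y²` (part of a regular system of parameters AT `y`), and `w` positive weights. Then there is
an affine open `y ∈ V ⊆ U` such that EVERY Rees algebra `R` on `Y` whose pieces over `V` are the weighted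
monomial ideals `(u|_V^α : Σ wᵢ αᵢ ≥ n)` has `(V, u|_V, w)` as a weighted chart (Włodarczyk 2.1.10: the `uᵢ` are
part of a regular system of parameters at every point of `V(u) ∩ V`). [cite: Wlodarczyk2022, 2.1.10 and Lemma 2.1.12] -/
theorem exists_affineOpens_isWeightedChart_of_linearIndependent {k : Type u} [Field k] [PerfectField k]
    {Y : Scheme.{u}} (f : Y ⟶ Spec (.of k)) [LocallyOfFiniteType f] (U : Y.affineOpens) {y : Y}
    (hy : y ∈ (U : Y.Opens)) [IsRegularLocalRing (Y.presheaf.stalk y)] {m : ℕ} (u : Fin m → Γ(Y, U))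
    (hu : ∀ i, (Y.presheaf.germ (U : Y.Opens) y hy).hom (u i) ∈ maximalIdeal (Y.presheaf.stalk y))
    (hli : LinearIndependent (ResidueField (Y.presheaf.stalk y))
      fun i => (maximalIdeal (Y.presheaf.stalk y)).toCotangent ⟨_, hu i⟩)
    (w : Fin m → ℕ) (hw : ∀ i, 0 < w i) :
    ∃ (V : Y.affineOpens) (hVU : (V : Y.Opens) ≤ U), y ∈ (V : Y.Opens) ∧
      ∀ R : ReesAlgebraData Y,
        (∀ n, (R.piece n).ideal V =
          weightedMonomialIdeal (fun i => (Y.presheaf.map (homOfLE hVU).op).hom (u i)) w n) →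
        R.IsWeightedChart V (fun i => (Y.presheaf.map (homOfLE hVU).op).hom (u i)) w := by
  obtain ⟨V, hVU, hyV, hspread⟩ := exists_affineOpens_forall_linearIndependent_toCotangent f U hy u hu hli
  exact ⟨V, hVU, hyV, fun R hR => ⟨hw, hR, fun y' hy' h => (hspread y' hy' h).2⟩⟩

/-- **ALGEBRAIZE, chart form, smooth ambient** (the door's regime: `Y → Spec k` smooth, `k` perfect): as
`exists_affineOpens_isWeightedChart_of_linearIndependent`, the regularity of `𝒪_{Y,y}` being automatic
(Stacks 056S, tree `isRegularLocalRing_stalk_of_smooth_of_field`). [cite: Wlodarczyk2022, 2.1.10] -/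
theorem exists_affineOpens_isWeightedChart_of_linearIndependent_of_smooth {k : Type u} [Field k]
    [PerfectField k] {Y : Scheme.{u}} (f : Y ⟶ Spec (.of k)) [Smooth f] (U : Y.affineOpens) {y : Y}
    (hy : y ∈ (U : Y.Opens)) {m : ℕ} (u : Fin m → Γ(Y, U))
    (hu : ∀ i, (Y.presheaf.germ (U : Y.Opens) y hy).hom (u i) ∈ maximalIdeal (Y.presheaf.stalk y))
    (hli : LinearIndependent (ResidueField (Y.presheaf.stalk y))
      fun i => (maximalIdeal (Y.presheaf.stalk y)).toCotangent ⟨_, hu i⟩)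
    (w : Fin m → ℕ) (hw : ∀ i, 0 < w i) :
    ∃ (V : Y.affineOpens) (hVU : (V : Y.Opens) ≤ U), y ∈ (V : Y.Opens) ∧
      ∀ R : ReesAlgebraData Y,
        (∀ n, (R.piece n).ideal V =
          weightedMonomialIdeal (fun i => (Y.presheaf.map (homOfLE hVU).op).hom (u i)) w n) →
        R.IsWeightedChart V (fun i => (Y.presheaf.map (homOfLE hVU).op).hom (u i)) w := by
  haveI : IsRegularLocalRing (Y.presheaf.stalk y) := isRegularLocalRing_stalk_of_smooth_of_field f y
  exact exists_affineOpens_isWeightedChart_of_linearIndependent f U hy u hu hli w hw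

end Chart

/-! ## A3. Glue for the e.f.t. move format (appended 2026-08-27, res-L1-w43-stub-9): units, zero weights, minimal generators -/

section Glue

variable {A : Type*} [CommRing A] {m : ℕ}

/-- **Unit scaling does not change the weighted filtration**: if `vᵢ = tᵢ uᵢ` with `tᵢ` units, then
`I_n(v) = I_n(u)` for all `n` (e.g. clearing denominators of germs by units of the local ring).
[cite: Wlodarczyk2022, Lemma 2.1.12] -/
theorem weightedMonomialIdeal_eq_of_forall_isUnit_mul (u v : Fin m → A) (w : Fin m → ℕ) (t : Fin m → A)
    (ht : ∀ i, IsUnit (t i)) (hv : ∀ i, v i = t i * u i) (n : ℕ) :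
    weightedMonomialIdeal v w n = weightedMonomialIdeal u w n := by
  refine le_antisymm (weightedMonomialIdeal_le_of_forall_mem u v w (fun i => ?_) n)
    (weightedMonomialIdeal_le_of_forall_mem v u w (fun i => ?_) n)
  · rw [hv i]
    exact Ideal.mul_mem_left _ _ (self_mem_weightedMonomialIdeal u w i)
  · obtain ⟨c, hc⟩ := (ht i).exists_left_inv
    have : u i = c * v i := by rw [hv i, ← mul_assoc, hc, one_mul]
    rw [this]
    exact Ideal.mul_mem_left _ _ (self_mem_weightedMonomialIdeal v w i)

/-- **Zero-weight parameters are redundant**: if the injection `σ : Fin m' → Fin m` hits every index of positive weight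
(typically: `σ` enumerates exactly `{i | wᵢ > 0}`), then the weighted filtration of `(u, w)` is that of the sub-family
`(u ∘ σ, w ∘ σ)` — a move of the local game with some weights `0` (positive-dimensional centre `V(uᵢ : wᵢ > 0)`) is read
by the all-weights-positive charts of `ReesAlgebraData.IsWeightedChart` without re-typing.
[cite: Wlodarczyk2022, Lemma 2.1.12] -/
theorem weightedMonomialIdeal_eq_comp_of_forall_mem_range {m' : ℕ} (u : Fin m → A) (w : Fin m → ℕ)
    (σ : Fin m' → Fin m) (hσ : Function.Injective σ) (hsurj : ∀ i, 0 < w i → i ∈ Set.range σ) (n : ℕ) :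
    weightedMonomialIdeal u w n = weightedMonomialIdeal (u ∘ σ) (w ∘ σ) n := by
  classical
  apply le_antisymm
  · -- a monomial `u^α` is a multiple of the monomial in the positively weighted variables, of the same weight
    rw [weightedMonomialIdeal, Ideal.span_le]
    rintro _ ⟨α, hα, rfl⟩
    have hsplit : ∏ i, u i ^ α i =
        (∏ i ∈ Finset.univ.filter (fun i => i ∉ Set.range σ), u i ^ α i) *
          ∏ i ∈ Finset.univ.filter (fun i => i ∈ Set.range σ), u i ^ α i := by
      rw [mul_comm, Finset.prod_filter_mul_prod_filter_not]
    have hreidx : ∏ i ∈ Finset.univ.filter (fun i => i ∈ Set.range σ), u i ^ α i = ∏ j, (u ∘ σ) j ^ α (σ j) := by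
      rw [show Finset.univ.filter (fun i => i ∈ Set.range σ) = Finset.univ.image σ by
        ext i; simp [Set.mem_range, eq_comm]]
      rw [Finset.prod_image (fun j _ j' _ h => hσ h)]
      rfl
    have hwt : n ≤ ∑ j, (w ∘ σ) j * α (σ j) := by
      refine hα.trans (le_of_eq ?_)
      have hzero : ∀ i ∈ Finset.univ.filter (fun i => i ∉ Set.range σ), w i * α i = 0 := by
        intro i hi
        have hi' : i ∉ Set.range σ := (Finset.mem_filter.mp hi).2
        have : w i = 0 := by
          by_contra h
          exact hi' (hsurj i (Nat.pos_of_ne_zero h))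
        rw [this, zero_mul]
      rw [← Finset.sum_filter_add_sum_filter_not Finset.univ (fun i => i ∈ Set.range σ),
        Finset.sum_eq_zero hzero, add_zero,
        show Finset.univ.filter (fun i => i ∈ Set.range σ) = Finset.univ.image σ by
          ext i; simp [Set.mem_range, eq_comm],
        Finset.sum_image (fun j _ j' _ h => hσ h)]
      rfl
    rw [hsplit, hreidx]
    exact Ideal.mul_mem_left _ _ (prod_pow_mem_weightedMonomialIdeal (u ∘ σ) (w ∘ σ) (fun j => α (σ j)) hwt)
  · -- a monomial in the sub-family is a monomial of `u` with exponent extended by zero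
    rw [weightedMonomialIdeal, Ideal.span_le]
    rintro _ ⟨β, hβ, rfl⟩
    let α : Fin m → ℕ := fun i => if h : i ∈ Set.range σ then β (Classical.choose h) else 0
    have hασ : ∀ j, α (σ j) = β j := by
      intro j
      have h : σ j ∈ Set.range σ := ⟨j, rfl⟩
      simp only [α, dif_pos h]
      congr 1
      exact hσ (Classical.choose_spec h)
    have hprod : ∏ j, (u ∘ σ) j ^ β j = ∏ i, u i ^ α i := by
      rw [← Finset.prod_filter_mul_prod_filter_not Finset.univ (fun i => i ∈ Set.range σ)]
      have h1 : ∏ i ∈ Finset.univ.filter (fun i => i ∉ Set.range σ), u i ^ α i = 1 :=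
        Finset.prod_eq_one fun i hi => by
          have hi' : i ∉ Set.range σ := (Finset.mem_filter.mp hi).2
          simp only [α, dif_neg hi', pow_zero]
      rw [h1, mul_one, show Finset.univ.filter (fun i => i ∈ Set.range σ) = Finset.univ.image σ by
        ext i; simp [Set.mem_range, eq_comm], Finset.prod_image (fun j _ j' _ h => hσ h)]
      exact Finset.prod_congr rfl fun j _ => by rw [Function.comp_apply, hασ j]
    have hwt : n ≤ ∑ i, w i * α i := by
      refine hβ.trans (le_of_eq ?_)
      rw [← Finset.sum_filter_add_sum_filter_not Finset.univ (fun i => i ∈ Set.range σ)]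
      have h0 : ∑ i ∈ Finset.univ.filter (fun i => i ∉ Set.range σ), w i * α i = 0 :=
        Finset.sum_eq_zero fun i hi => by
          have hi' : i ∉ Set.range σ := (Finset.mem_filter.mp hi).2
          simp only [α, dif_neg hi', mul_zero]
      rw [h0, add_zero, show Finset.univ.filter (fun i => i ∈ Set.range σ) = Finset.univ.image σ by
        ext i; simp [Set.mem_range, eq_comm], Finset.sum_image (fun j _ j' _ h => hσ h)]
      exact Finset.sum_congr rfl fun j _ => by rw [Function.comp_apply, hασ j]
    rw [hprod]
    exact prod_pow_mem_weightedMonomialIdeal u w α hwt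

/-- **A minimal generating system of the maximal ideal of a regular local ring has independent differentials**
(the move clause «`span u = 𝔪_S ∧ spanFinrank 𝔪_S = n`» of the e.f.t. local game delivers the hypothesis of
`exists_affineOpens_isWeightedChart_of_linearIndependent`, for the whole system and hence for every sub-family).
[cite: Matsumura1987, Thm. 14.2] -/
theorem linearIndependent_toCotangent_of_span_eq_of_spanFinrank_eq {R : Type*} [CommRing R] [IsRegularLocalRing R]
    {n : ℕ} (u : Fin n → R) (hspan : Ideal.span (Set.range u) = maximalIdeal R)
    (hn : (maximalIdeal R).spanFinrank = n) :
    LinearIndependent (ResidueField R) fun i =>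
      (maximalIdeal R).toCotangent ⟨u i, hspan ▸ Ideal.subset_span ⟨i, rfl⟩⟩ := by
  rw [linearIndependent_toCotangent_iff_forall_mem]
  exact fun c hc i => mem_maximalIdeal_of_sum_mul_rsop_mem_sq hn u hspan c hc i

/-- Sub-families of a family with independent differentials have independent differentials (e.g. the positively
weighted parameters of a move). [cite: Matsumura1987, Thm. 14.2] -/
theorem linearIndependent_toCotangent_comp {R : Type*} [CommRing R] [IsLocalRing R] {n m' : ℕ} (u : Fin n → R)
    (hu : ∀ i, u i ∈ maximalIdeal R)
    (hli : LinearIndependent (ResidueField R) fun i => (maximalIdeal R).toCotangent ⟨u i, hu i⟩)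
    (σ : Fin m' → Fin n) (hσ : Function.Injective σ) :
    LinearIndependent (ResidueField R) fun j => (maximalIdeal R).toCotangent ⟨u (σ j), hu (σ j)⟩ :=
  hli.comp σ hσ

end Glue

end Literature.AlgebraicGeometry.Resolution.WeightedInvariant

end Part2

/-!
## Part 3 — port of `Summits/ResolutionOfSingularities/ResolutionOfSingularities/Theorems/WeightedInvariantHypersurfaceLocalGameEFTDimTwoSteepening.lean`

# The e.f.t. local weighted game (door `HypersurfaceCentreConstruction`): Newton faces and steepening

Topic: `Summits/ResolutionOfSingularities/ResolutionOfSingularities/Theorems`. Helper for the door item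
`HypersurfaceCentreConstruction` (statement `stmt-ResolutionOfSingularities-19897`, route `WeightedInvariant`),
line `local-engine` of `res-L1-w43-plan-1` (L W4.3), ORDER (o13) «the `dim S = 2` rung of H2a′» held by
res-type-098: kernel **K5 «Newton data + steepening»** of the design memo `L/res-type-098-w43/EFT-DIM2-DESIGN.md`
(sha16 `57346d14bde74e12`, §2 cases C/D/D′, §4 row K5), PART 1 = the DEF-FREE `J_b`-interface proposed by the reserve
hand res-type-078 (STATUS 2026-08-27T06:44Z), accepted by res-type-098 (07:07:16Z «K5: YOURS … accepted as is») and adopted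
by res-L1-w43-plan-1 RULING gen 8 #3 (K5 PART 2 `…EFTDimTwoNewton`, the Δ-expansion currency, is res-type-092's); it feeds
K6 (`…EFTDimTwoContact`, p505670) and K3a (`LocalGameEFTPointMove`, p507345).

[OURS · L1 W4.3] Replaces the role of NO printed item; NOT a statement of the manuscript
[claim: Hironaka2017, status: under-review]. AI work, weaker than expert review.

## Content (weights `(1, b)` on a pair `(x, y)`; `J_b(n) := weightedMonomialIdeal ![x, y] ![1, b] n`)

* (K5a) `weightedMonomialIdeal_steepen_eq`, `span_pair_steepen_eq` — STEEPENING `y ↦ y - c·x^b` changes neither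
  the filtration `J_b` nor the ideal `(x, y)` (jets lemma, tree `weightedMonomialIdeal_eq_of_forall_sub_mem`).
* (K5b) `exists_face` — FACE EXTRACTION: `f ∈ J_b(bν)` ⇒ `f ≡ Σ_{j ≤ ν} a_j x^{b(ν-j)} y^j (mod J_b(bν+1))`.
* (K5c) `face_coeff_mem_maximalIdeal` — FACE UNIQUENESS mod `𝔪` in a two-dimensional regular local ring with
  `(x, y) = 𝔪` (weighted quasi-regularity, tree `weightedQuasiRegular_of_linearIndependent_toCotangent`): a face
  lying in `J_b(bν+1)` has all its coefficients in `𝔪`; so the FACE POLYNOMIAL `Σ ā_j s^j ∈ κ[s]` is well defined.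
* (K5d) `sub_mul_steepen_pow_mem_of_face`, `exists_steepen_of_face_eq_pow` — a `ν`-TH-POWER FACE `c̄ (s - λ̄)^ν`
  is killed by the steepening `y' = y - λ̃ x^b`: `f ≡ c·y'^ν (mod J_b(bν+1))` with `c` a unit (case D′ of the memo).
* (K5e) glue: `maximalIdeal_mul_le`, `weightedMonomialIdeal_one_eq_pow` (`J_1(n) = 𝔪^n`),
  `weightedMonomialIdeal_le_span_pair` (`J_b(bν) ⊆ (y^ν, x^b)`), `weightedMonomialIdeal_le_span_sup_pow`
  (`J_b(bν) ⊆ (y^ν) + 𝔪^b`, the hypothesis shape of K6), `not_mem_sq_of_span_pair_eq` (`x, y ∉ 𝔪²`).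

## References

* J. Włodarczyk, *Functorial resolution by torus actions*, arXiv:2203.03090, Lemma 2.1.12, §2.3.9. [Wlodarczyk2022]
* H. Matsumura, *Commutative Ring Theory*, Thm. 16.2 (quasi-regularity), Thm. 14.2. [Matsumura1987]
-/

section Part3


open _root_.IsLocalRing _root_.Literature.AlgebraicGeometry.Resolution

namespace Literature.AlgebraicGeometry.Resolution.WeightedInvariant

namespace LocalGameEFTSteepening

universe u

variable {S : Type u} [CommRing S]

/-! ### Monomials of the face -/

/-- The face monomial `x^{b(ν-j)} y^j` (`j ≤ ν`) has `(1,b)`-weight `bν`. [cite: Wlodarczyk2022, Lemma 2.1.12] -/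
theorem faceMonomial_mem (x y : S) (b ν : ℕ) {j : ℕ} (hj : j ≤ ν) :
    x ^ (b * (ν - j)) * y ^ j ∈ weightedMonomialIdeal ![x, y] ![1, b] (b * ν) := by
  have h := prod_pow_mem_weightedMonomialIdeal ![x, y] ![1, b] (n := b * ν) ![b * (ν - j), j] (by
    simp only [Fin.sum_univ_two, Matrix.cons_val_zero, Matrix.cons_val_one, one_mul]
    have : b * (ν - j) + b * j = b * ν := by
      rw [← Nat.mul_add, Nat.sub_add_cancel hj]
    omega)
  simpa [Fin.prod_univ_two] using h

/-- `x ∈ J_b(1)`. [cite: Wlodarczyk2022, Lemma 2.1.12] -/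
theorem fst_mem_one (x y : S) (b : ℕ) : x ∈ weightedMonomialIdeal ![x, y] ![1, b] 1 := by
  simpa using self_mem_weightedMonomialIdeal ![x, y] ![1, b] 0

/-- `y ∈ J_b(b)`. [cite: Wlodarczyk2022, Lemma 2.1.12] -/
theorem snd_mem (x y : S) (b : ℕ) : y ∈ weightedMonomialIdeal ![x, y] ![1, b] b := by
  simpa using self_mem_weightedMonomialIdeal ![x, y] ![1, b] 1

/-- `x^k ∈ J_b(k)`. [cite: Wlodarczyk2022, Lemma 2.1.12] -/
theorem fst_pow_mem (x y : S) (b k : ℕ) : x ^ k ∈ weightedMonomialIdeal ![x, y] ![1, b] k := by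
  simpa using pow_mem_weightedMonomialIdeal ![x, y] ![1, b] (fst_mem_one x y b) k
/-! ### (K5a) Steepening does not change the filtration -/

/-- **(K5a) Steepening invariance of the weighted filtration**: `J_b(n)(x, y - c x^b) = J_b(n)(x, y)` for all
`n` (the perturbation `c x^b` has weight `b`). [cite: Wlodarczyk2022, Lemma 2.1.12] -/
theorem weightedMonomialIdeal_steepen_eq (x y c : S) (b n : ℕ) :
    weightedMonomialIdeal ![x, y - c * x ^ b] ![1, b] n = weightedMonomialIdeal ![x, y] ![1, b] n := by
  refine weightedMonomialIdeal_eq_of_forall_sub_mem ![x, y] ![x, y - c * x ^ b] ![1, b]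
    (Fin.forall_fin_two.2 ⟨?_, ?_⟩) (Fin.forall_fin_two.2 ⟨?_, ?_⟩) n
  · simp
  · simpa using neg_mem (Ideal.mul_mem_left _ c (fst_pow_mem x y b b))
  · simp
  · simpa using Ideal.mul_mem_left _ c (fst_pow_mem x (y - c * x ^ b) b b)

/-- Steepening does not change the ideal `(x, y)`: `(x, y - c x^b) = (x, y)` for `b ≥ 1`. [folklore] -/
private theorem span_pair_steepen_eq (x y c : S) {b : ℕ} (hb : 1 ≤ b) :
    Ideal.span {x, y - c * x ^ b} = Ideal.span {x, y} := by
  obtain ⟨b', rfl⟩ := Nat.exists_eq_add_of_le hb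
  apply le_antisymm
  · rw [Ideal.span_le, Set.insert_subset_iff, Set.singleton_subset_iff]
    exact ⟨Ideal.subset_span (by simp), Ideal.mem_span_pair.2 ⟨-(c * x ^ b'), 1, by ring⟩⟩
  · rw [Ideal.span_le, Set.insert_subset_iff, Set.singleton_subset_iff]
    exact ⟨Ideal.subset_span (by simp), Ideal.mem_span_pair.2 ⟨c * x ^ b', 1, by ring⟩⟩
/-! ### (K5e) Glue lemmas -/

/-- `(x, y)^k ⊆ J_b(k)` when `b ≥ 1`. [cite: Wlodarczyk2022, Lemma 2.1.12] -/
theorem span_pair_pow_le (x y : S) {b : ℕ} (hb : 1 ≤ b) (k : ℕ) :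
    Ideal.span {x, y} ^ k ≤ weightedMonomialIdeal ![x, y] ![1, b] k := by
  refine pow_le_weightedMonomialIdeal_of_span_eq ![x, y] ![1, b] (Fin.forall_fin_two.2 ⟨by simp, by simpa⟩)
    ?_ k
  rw [Matrix.range_cons_cons_empty]

/-- `(x, y) · J_b(n) ⊆ J_b(n+1)` when `b ≥ 1` (each of `x, y` has positive weight). [cite: Wlodarczyk2022, Lemma 2.1.12] -/
theorem span_pair_mul_le (x y : S) {b : ℕ} (hb : 1 ≤ b) (n : ℕ) :
    Ideal.span {x, y} * weightedMonomialIdeal ![x, y] ![1, b] n ≤ weightedMonomialIdeal ![x, y] ![1, b] (n + 1) := by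
  have h1 : Ideal.span {x, y} ≤ weightedMonomialIdeal ![x, y] ![1, b] 1 := by
    simpa using span_pair_pow_le x y hb 1
  rw [Nat.add_comm]
  exact (Ideal.mul_mono_left h1).trans (weightedMonomialIdeal_mul_le ![x, y] ![1, b] 1 n)

/-- **`J_1(n) = (x, y)^n`** (all weights one). [cite: Wlodarczyk2022, Lemma 2.1.12] -/
theorem weightedMonomialIdeal_one_eq_pow (x y : S) (n : ℕ) :
    weightedMonomialIdeal ![x, y] ![1, 1] n = Ideal.span {x, y} ^ n := by
  refine le_antisymm ?_ (span_pair_pow_le x y le_rfl n)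
  rw [weightedMonomialIdeal, Ideal.span_le]
  rintro _ ⟨α, hα, rfl⟩
  simp only [Fin.sum_univ_two, Matrix.cons_val_zero, Matrix.cons_val_one, one_mul] at hα
  rw [Fin.prod_univ_two]
  simp only [Matrix.cons_val_zero, Matrix.cons_val_one, SetLike.mem_coe]
  have hx : x ^ α 0 ∈ Ideal.span {x, y} ^ α 0 := Ideal.pow_mem_pow (Ideal.subset_span (by simp)) _
  have hy : y ^ α 1 ∈ Ideal.span {x, y} ^ α 1 := Ideal.pow_mem_pow (Ideal.subset_span (by simp)) _
  exact Ideal.pow_le_pow_right hα (by rw [pow_add]; exact Ideal.mul_mem_mul hx hy)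

/-- **`J_b(bν) ⊆ (y^ν, x^b)`**: a monomial `x^i y^j` of weight `i + bj ≥ bν` has `j ≥ ν` or `i ≥ b`.
[cite: Wlodarczyk2022, Lemma 2.1.12] -/
theorem weightedMonomialIdeal_le_span_pair (x y : S) (b ν : ℕ) :
    weightedMonomialIdeal ![x, y] ![1, b] (b * ν) ≤ Ideal.span {y ^ ν, x ^ b} := by
  rw [weightedMonomialIdeal, Ideal.span_le]
  rintro _ ⟨α, hα, rfl⟩
  simp only [Fin.sum_univ_two, Matrix.cons_val_zero, Matrix.cons_val_one, one_mul] at hα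
  rw [Fin.prod_univ_two]
  simp only [Matrix.cons_val_zero, Matrix.cons_val_one, SetLike.mem_coe]
  by_cases hj : ν ≤ α 1
  · obtain ⟨d, hd⟩ := Nat.exists_eq_add_of_le hj
    rw [hd, pow_add]
    exact Ideal.mul_mem_left _ _ (Ideal.mul_mem_right _ _ (Ideal.subset_span (by simp)))
  · have hi : b ≤ α 0 := by
      push Not at hj
      have : b * α 1 + b ≤ b * ν := by
        rw [← Nat.mul_succ]
        exact Nat.mul_le_mul_left _ hj
      omega
    obtain ⟨d, hd⟩ := Nat.exists_eq_add_of_le hi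
    rw [hd, pow_add]
    exact Ideal.mul_mem_right _ _ (Ideal.mul_mem_right _ _ (Ideal.subset_span (by simp)))

/-- **`J_b(bν) ⊆ (y^ν) + 𝔪^b`** when `x ∈ 𝔪` — the hypothesis shape of K6
(`LocalGameEFTContact.exists_associated_pow_of_adicSteepening`). [cite: Wlodarczyk2022, Lemma 2.1.12] -/
theorem weightedMonomialIdeal_le_span_sup_pow [IsLocalRing S] {x : S} (hx : x ∈ maximalIdeal S) (y : S)
    (b ν : ℕ) :
    weightedMonomialIdeal ![x, y] ![1, b] (b * ν) ≤ Ideal.span {y ^ ν} ⊔ maximalIdeal S ^ b := by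
  refine (weightedMonomialIdeal_le_span_pair x y b ν).trans ?_
  rw [Ideal.span_insert]
  exact sup_le_sup_left ((Ideal.span_singleton_le_iff_mem _).2 (Ideal.pow_mem_pow hx b)) _

/-- In a regular local ring of dimension two, two generators `x, y` of `𝔪` lie outside `𝔪²`. [cite: Matsumura1987, Thm. 14.2] -/
theorem not_mem_sq_of_span_pair_eq [IsRegularLocalRing S] (hdim : ringKrullDim S = (2 : ℕ)) {x y : S}
    (hxy : Ideal.span {x, y} = maximalIdeal S) :
    x ∉ maximalIdeal S ^ 2 ∧ y ∉ maximalIdeal S ^ 2 := by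
  have hspan : Ideal.span (Set.range ![x, y]) = maximalIdeal S := by
    rw [Matrix.range_cons_cons_empty, hxy]
  have hli := linearIndependent_toCotangent_of_span_eq_maximalIdeal hdim ![x, y] hspan
  have hmem : ∀ i, ![x, y] i ∈ maximalIdeal S := fun i => hspan ▸ Ideal.subset_span ⟨i, rfl⟩
  rw [linearIndependent_toCotangent_iff_forall_mem _ hmem] at hli
  constructor
  · intro hx
    have h := hli ![1, 0] (by simpa [Fin.sum_univ_two] using hx) 0
    simp only [Matrix.cons_val_zero] at h
    exact (IsLocalRing.maximalIdeal.isMaximal S).ne_top (Ideal.eq_top_of_isUnit_mem _ h isUnit_one)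
  · intro hy
    have h := hli ![0, 1] (by simpa [Fin.sum_univ_two] using hy) 1
    simp only [Matrix.cons_val_one] at h
    exact (IsLocalRing.maximalIdeal.isMaximal S).ne_top (Ideal.eq_top_of_isUnit_mem _ h isUnit_one)

/-! ### (K5b) Face extraction -/

/-- **(K5b) Face extraction**: if `f ∈ J_b(bν)` (`b ≥ 1`) then `f ≡ Σ_{j ≤ ν} a_j x^{b(ν-j)} y^j` modulo `J_b(bν+1)`
for some coefficients `a_j ∈ S`. [cite: Wlodarczyk2022, Lemma 2.1.12] -/
theorem exists_face {x y f : S} {b : ℕ} (hb : 1 ≤ b) {ν : ℕ}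
    (hf : f ∈ weightedMonomialIdeal ![x, y] ![1, b] (b * ν)) :
    ∃ a : ℕ → S, f - ∑ j ∈ Finset.range (ν + 1), a j * (x ^ (b * (ν - j)) * y ^ j) ∈
      weightedMonomialIdeal ![x, y] ![1, b] (b * ν + 1) := by
  classical
  rw [weightedMonomialIdeal] at hf
  refine Submodule.span_induction (p := fun z _ => ∃ a : ℕ → S,
      z - ∑ j ∈ Finset.range (ν + 1), a j * (x ^ (b * (ν - j)) * y ^ j) ∈
        weightedMonomialIdeal ![x, y] ![1, b] (b * ν + 1)) ?_ ?_ ?_ ?_ hf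
  · rintro z ⟨α, hα, rfl⟩
    simp only [Fin.sum_univ_two, Matrix.cons_val_zero, Matrix.cons_val_one, one_mul] at hα
    by_cases hgt : b * ν + 1 ≤ α 0 + b * α 1
    · refine ⟨0, ?_⟩
      simp only [Pi.zero_apply, zero_mul, Finset.sum_const_zero, sub_zero]
      exact prod_pow_mem_weightedMonomialIdeal ![x, y] ![1, b] α (by simpa [Fin.sum_univ_two] using hgt)
    · have heq : α 0 + b * α 1 = b * ν := by omega
      have hj : α 1 ≤ ν := by
        by_contra h
        push Not at h
        have : b * ν + b ≤ b * α 1 := by rw [← Nat.mul_succ]; exact Nat.mul_le_mul_left _ h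
        omega
      have h0 : α 0 = b * (ν - α 1) := by
        rw [mul_tsub]
        omega
      refine ⟨Pi.single (α 1) 1, ?_⟩
      rw [Finset.sum_eq_single (α 1) (fun j _ hj' => by rw [Pi.single_eq_of_ne hj', zero_mul])
        (fun h => absurd (Finset.mem_range.2 (Nat.lt_succ_of_le hj)) h), Pi.single_eq_same, one_mul,
        Fin.prod_univ_two]
      simp only [Matrix.cons_val_zero, Matrix.cons_val_one]
      rw [h0, sub_self]
      exact Ideal.zero_mem _
  · exact ⟨0, by simp⟩
  · rintro z₁ z₂ - - ⟨a₁, h₁⟩ ⟨a₂, h₂⟩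
    refine ⟨a₁ + a₂, ?_⟩
    have : z₁ + z₂ - ∑ j ∈ Finset.range (ν + 1), (a₁ + a₂) j * (x ^ (b * (ν - j)) * y ^ j) =
        (z₁ - ∑ j ∈ Finset.range (ν + 1), a₁ j * (x ^ (b * (ν - j)) * y ^ j)) +
          (z₂ - ∑ j ∈ Finset.range (ν + 1), a₂ j * (x ^ (b * (ν - j)) * y ^ j)) := by
      simp only [Pi.add_apply, add_mul, Finset.sum_add_distrib]
      ring
    rw [this]
    exact Ideal.add_mem _ h₁ h₂
  · rintro r z - ⟨a, h⟩
    refine ⟨fun j => r * a j, ?_⟩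
    have : r • z - ∑ j ∈ Finset.range (ν + 1), r * a j * (x ^ (b * (ν - j)) * y ^ j) =
        r * (z - ∑ j ∈ Finset.range (ν + 1), a j * (x ^ (b * (ν - j)) * y ^ j)) := by
      rw [smul_eq_mul, mul_sub, Finset.mul_sum]
      refine congrArg _ (Finset.sum_congr rfl fun j _ => ?_)
      ring
    rw [this]
    exact Ideal.mul_mem_left _ _ h

/-! ### (K5c) Face uniqueness modulo `𝔪` -/

/-- **(K5c) Face uniqueness mod `𝔪`** (weighted quasi-regularity of a regular system of parameters): in a
regular local ring of dimension two with `(x, y) = 𝔪` and `b ≥ 1`, if `Σ_{j ≤ ν} a_j x^{b(ν-j)} y^j ∈ J_b(bν+1)`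
then every `a_j` (`j ≤ ν`) lies in `𝔪`.  Hence the face polynomial `Σ_j ā_j s^j ∈ κ[s]` of `f ∈ J_b(bν)` is well
defined. [cite: Matsumura1987, Thm. 16.2] [cite: Wlodarczyk2022, §2.3.9] -/
theorem face_coeff_mem_maximalIdeal [IsRegularLocalRing S] (hdim : ringKrullDim S = (2 : ℕ)) {x y : S}
    (hxy : Ideal.span {x, y} = maximalIdeal S) {b : ℕ} (hb : 1 ≤ b) {ν : ℕ} (a : ℕ → S)
    (h : ∑ j ∈ Finset.range (ν + 1), a j * (x ^ (b * (ν - j)) * y ^ j) ∈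
      weightedMonomialIdeal ![x, y] ![1, b] (b * ν + 1)) {j : ℕ} (hj : j ≤ ν) :
    a j ∈ maximalIdeal S := by
  classical
  set u : Fin 2 → S := ![x, y] with hu
  set w : Fin 2 → ℕ := ![1, b] with hw
  have hspan : Ideal.span (Set.range u) = maximalIdeal S := by
    rw [hu, Matrix.range_cons_cons_empty, hxy]
  have hmem : ∀ i, u i ∈ maximalIdeal S := fun i => hspan ▸ Ideal.subset_span ⟨i, rfl⟩
  have hli := linearIndependent_toCotangent_of_span_eq_maximalIdeal hdim u hspan
  have hwpos : ∀ i, 0 < w i := Fin.forall_fin_two.2 ⟨by simp [hw], by simpa [hw]⟩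
  -- the face as a weighted form
  let e : ℕ → (Fin 2 →₀ ℕ) := fun j => Finsupp.single 0 (b * (ν - j)) + Finsupp.single 1 j
  let P : MvPolynomial (Fin 2) S := ∑ j ∈ Finset.range (ν + 1), MvPolynomial.monomial (e j) (a j)
  have he1 : ∀ j, e j 1 = j := fun j => by simp [e]
  have he0 : ∀ j, e j 0 = b * (ν - j) := fun j => by simp [e]
  have hweight : ∀ j ∈ Finset.range (ν + 1), Finsupp.weight w (e j) = b * ν := by
    intro j hj'
    have hj' := Nat.lt_succ_iff.1 (Finset.mem_range.1 hj')
    rw [Finsupp.weight_apply, Finsupp.sum_fintype _ _ (fun i => by simp), Fin.sum_univ_two, he0, he1]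
    simp only [hw, Matrix.cons_val_zero, Matrix.cons_val_one, smul_eq_mul, mul_one]
    rw [Nat.mul_comm j b, ← Nat.mul_add, Nat.sub_add_cancel hj']
  have hP : P.IsWeightedHomogeneous w (b * ν) := by
    rw [← MvPolynomial.mem_weightedHomogeneousSubmodule]
    refine Submodule.sum_mem _ fun j hj' => ?_
    rw [MvPolynomial.mem_weightedHomogeneousSubmodule]
    exact MvPolynomial.isWeightedHomogeneous_monomial w (e j) (a j) (hweight j hj')
  have hprod : ∀ j, (e j).prod (fun n k => u n ^ k) = x ^ (b * (ν - j)) * y ^ j := fun j => by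
    show (Finsupp.single (0 : Fin 2) (b * (ν - j)) + Finsupp.single 1 j).prod (fun n k => u n ^ k) = _
    rw [Finsupp.prod_add_index' (fun i => pow_zero _) (fun i m n => pow_add _ _ _),
      Finsupp.prod_single_index (h := fun n k => u n ^ k) (pow_zero _),
      Finsupp.prod_single_index (h := fun n k => u n ^ k) (pow_zero _)]
    simp [hu]
  have heval : MvPolynomial.eval u P = ∑ j ∈ Finset.range (ν + 1), a j * (x ^ (b * (ν - j)) * y ^ j) := by
    simp only [P, map_sum, MvPolynomial.eval_monomial, hprod]
  have hcoeff : P.coeff (e j) = a j := by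
    simp only [P, MvPolynomial.coeff_sum, MvPolynomial.coeff_monomial]
    rw [Finset.sum_eq_single j (fun j' _ hj'ne => if_neg fun h => hj'ne ?_)
      (fun h => absurd (Finset.mem_range.2 (Nat.lt_succ_of_le hj)) h), if_pos rfl]
    have := congrArg (fun d => d 1) h
    simpa [he1] using this
  have key := weightedQuasiRegular_of_linearIndependent_toCotangent u w hwpos hmem hli (b * ν) P hP (by
    rw [← weightedMonomialIdeal_eq_weightedFiltration_ideal, heval]
    exact h) (e j)
  rw [hcoeff, hspan] at key
  exact key

/-! ### (K5d) Steepening kills a `ν`-th-power face -/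

/-- The binomial expansion of the steepened power: `c (y - λ x^b)^ν = Σ_{j ≤ ν} (c·C(ν,j)·(-λ)^{ν-j}) x^{b(ν-j)} y^j`.
[folklore] -/
private theorem mul_steepen_pow_eq (x y c lam : S) (b ν : ℕ) :
    c * (y - lam * x ^ b) ^ ν =
      ∑ j ∈ Finset.range (ν + 1), (c * (ν.choose j : S) * (-lam) ^ (ν - j)) * (x ^ (b * (ν - j)) * y ^ j) := by
  rw [sub_eq_add_neg, add_pow, Finset.mul_sum]
  refine Finset.sum_congr rfl fun j _ => ?_
  rw [neg_pow, neg_pow, mul_pow, ← pow_mul]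
  ring

/-- **(K5d) Steepening kills a `ν`-th-power face**: if `f ≡ Σ a_j x^{b(ν-j)} y^j (mod J_b(bν+1))` and the
coefficients agree modulo `𝔪 = (x, y)` with those of `c (s - λ̃)^ν`, then `f ≡ c·(y - λ̃ x^b)^ν (mod J_b(bν+1))`
(`b ≥ 1`; the filtration is the same for `(x, y - λ̃ x^b)` by (K5a)). [cite: Wlodarczyk2022, Lemma 2.1.12] -/
theorem sub_mul_steepen_pow_mem_of_face [IsLocalRing S] {x y f : S} (hxy : Ideal.span {x, y} = maximalIdeal S)
    {b : ℕ} (hb : 1 ≤ b) {ν : ℕ} {a : ℕ → S}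
    (hface : f - ∑ j ∈ Finset.range (ν + 1), a j * (x ^ (b * (ν - j)) * y ^ j) ∈
      weightedMonomialIdeal ![x, y] ![1, b] (b * ν + 1))
    {c lam : S} (hres : ∀ j ∈ Finset.range (ν + 1), a j - c * (ν.choose j : S) * (-lam) ^ (ν - j) ∈ maximalIdeal S) :
    f - c * (y - lam * x ^ b) ^ ν ∈ weightedMonomialIdeal ![x, y] ![1, b] (b * ν + 1) := by
  have hsplit : f - c * (y - lam * x ^ b) ^ ν =
      (f - ∑ j ∈ Finset.range (ν + 1), a j * (x ^ (b * (ν - j)) * y ^ j)) +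
        ∑ j ∈ Finset.range (ν + 1),
          (a j - c * (ν.choose j : S) * (-lam) ^ (ν - j)) * (x ^ (b * (ν - j)) * y ^ j) := by
    rw [mul_steepen_pow_eq]
    simp only [sub_mul, Finset.sum_sub_distrib]
    ring
  rw [hsplit]
  refine Ideal.add_mem _ hface (Ideal.sum_mem _ fun j hj => ?_)
  have hjν : j ≤ ν := Nat.lt_succ_iff.1 (Finset.mem_range.1 hj)
  refine span_pair_mul_le x y hb (b * ν) (Ideal.mul_mem_mul ?_ (faceMonomial_mem x y b ν hjν))
  rw [hxy]
  exact hres j hj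

/-- **(K5d′) Steepening from a residue-field face**: in a local ring with `(x, y) = 𝔪`, if
`f ≡ Σ a_j x^{b(ν-j)} y^j (mod J_b(bν+1))` and the face polynomial is `c̄ (s - λ̄)^ν` over the residue field
(`ā_j = c̄·C(ν,j)·(-λ̄)^{ν-j}`, `c̄ ≠ 0`), then for lifts `c` (a unit), `λ̃` of `c̄, λ̄`:
`f ≡ c (y - λ̃ x^b)^ν (mod J_b(bν+1))`. [cite: Wlodarczyk2022, Lemma 2.1.12] -/
theorem exists_steepen_of_face_eq_pow [IsLocalRing S] {x y f : S} (hxy : Ideal.span {x, y} = maximalIdeal S)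
    {b : ℕ} (hb : 1 ≤ b) {ν : ℕ} {a : ℕ → S}
    (hface : f - ∑ j ∈ Finset.range (ν + 1), a j * (x ^ (b * (ν - j)) * y ^ j) ∈
      weightedMonomialIdeal ![x, y] ![1, b] (b * ν + 1))
    {cbar lbar : ResidueField S} (hc : cbar ≠ 0)
    (hP : ∀ j ∈ Finset.range (ν + 1), residue S (a j) = cbar * (ν.choose j : ResidueField S) * (-lbar) ^ (ν - j)) :
    ∃ c lam : S, IsUnit c ∧ residue S c = cbar ∧ residue S lam = lbar ∧
      f - c * (y - lam * x ^ b) ^ ν ∈ weightedMonomialIdeal ![x, y] ![1, b] (b * ν + 1) := by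
  obtain ⟨c, rfl⟩ := residue_surjective cbar
  obtain ⟨lam, rfl⟩ := residue_surjective lbar
  have hcu : IsUnit c := by
    by_contra h
    exact hc ((residue_eq_zero_iff c).2 ((mem_maximalIdeal _).2 h))
  refine ⟨c, lam, hcu, rfl, rfl, sub_mul_steepen_pow_mem_of_face hxy hb hface fun j hj => ?_⟩
  rw [← residue_eq_zero_iff, map_sub, map_mul, map_mul, map_pow, map_neg, map_natCast, hP j hj, sub_self]

/-- **(K5) START**: a rational `ν`-th-power tangent cone `f ≡ c y^ν (mod 𝔪^{ν+1})` is the level `b = 1` face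
statement `f ≡ c y^ν (mod J_1(ν+1))` (`J_1(n) = 𝔪^n`). [cite: Wlodarczyk2022, Lemma 2.1.12] -/
theorem sub_mem_weightedMonomialIdeal_one_of_sub_mem_pow [IsLocalRing S] {x y f c : S}
    (hxy : Ideal.span {x, y} = maximalIdeal S) {ν : ℕ} (h : f - c * y ^ ν ∈ maximalIdeal S ^ (ν + 1)) :
    f - c * y ^ ν ∈ weightedMonomialIdeal ![x, y] ![1, 1] (1 * ν + 1) := by
  rw [one_mul, weightedMonomialIdeal_one_eq_pow, hxy]
  exact h

/-- **(K5) the face of a pure power**: `f ≡ c y^ν (mod J_b(bν+1))` is the face statement with coefficients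
`a = (0, …, 0, c)`. [folklore] -/
private theorem face_of_sub_mul_pow_mem {x y f c : S} {b ν : ℕ}
    (h : f - c * y ^ ν ∈ weightedMonomialIdeal ![x, y] ![1, b] (b * ν + 1)) :
    f - ∑ j ∈ Finset.range (ν + 1), (Pi.single ν c : ℕ → S) j * (x ^ (b * (ν - j)) * y ^ j) ∈
      weightedMonomialIdeal ![x, y] ![1, b] (b * ν + 1) := by
  rw [Finset.sum_eq_single ν (fun j _ hj => by rw [Pi.single_eq_of_ne hj, zero_mul])
    (fun hν => absurd (Finset.self_mem_range_succ ν) hν), Pi.single_eq_same, Nat.sub_self, mul_zero, pow_zero,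
    one_mul]
  exact h

/-! ### Exports in the shapes K7 consumes (res-type-098 07:07:16Z (2)) -/

/-- A prepared level is a level: `f - c y^ν ∈ J_b(bν+1)` implies `f ∈ J_b(bν)` (`y^ν ∈ J_b(bν)`). [folklore] -/
private theorem mem_of_sub_mul_pow_mem {x y f c : S} {b ν : ℕ}
    (h : f - c * y ^ ν ∈ weightedMonomialIdeal ![x, y] ![1, b] (b * ν + 1)) :
    f ∈ weightedMonomialIdeal ![x, y] ![1, b] (b * ν) := by
  have hy : c * y ^ ν ∈ weightedMonomialIdeal ![x, y] ![1, b] (b * ν) := by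
    refine Ideal.mul_mem_left _ _ ?_
    simpa [Nat.mul_comm] using pow_mem_weightedMonomialIdeal ![x, y] ![1, b] (snd_mem x y b) ν
  simpa using Ideal.add_mem _ (weightedMonomialIdeal_antitone _ _ (Nat.le_succ _) h) hy

/-- **Case C package** (the literal triple res-type-098's K7 consumes for kernel K3): from a prepared level `b` —
`f ≡ c y^ν (mod J_b(bν+1))` with `c` a unit — which is NOT a level `b+1`, read off
`f ∈ J_b(bν) ∧ (∃ c unit, f - c y^ν ∈ J_b(bν+1)) ∧ f ∉ J_{b+1}((b+1)ν)` (first Newton slope `β*` with `⌊β*⌋ = b`,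
`β* ∉ ℤ`). [folklore] -/
private theorem caseC_package {x y f c : S} {b ν : ℕ} (hc : IsUnit c)
    (hprep : f - c * y ^ ν ∈ weightedMonomialIdeal ![x, y] ![1, b] (b * ν + 1))
    (hnext : f ∉ weightedMonomialIdeal ![x, y] ![1, b + 1] ((b + 1) * ν)) :
    f ∈ weightedMonomialIdeal ![x, y] ![1, b] (b * ν) ∧
      (∃ c : S, IsUnit c ∧ f - c * y ^ ν ∈ weightedMonomialIdeal ![x, y] ![1, b] (b * ν + 1)) ∧
      f ∉ weightedMonomialIdeal ![x, y] ![1, b + 1] ((b + 1) * ν) :=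
  ⟨mem_of_sub_mul_pow_mem hprep, ⟨c, hc, hprep⟩, hnext⟩

/-- The steepening step in K6's hypothesis shape: `(y - c x^b) - y ∈ (x^b)`. [folklore] -/
private theorem steepen_sub_mem (x y c : S) (b : ℕ) : (y - c * x ^ b) - y ∈ Ideal.span {x ^ b} :=
  Ideal.mem_span_singleton'.mpr ⟨-c, by ring⟩

end LocalGameEFTSteepening

end Literature.AlgebraicGeometry.Resolution.WeightedInvariant

end Part3

/-!
## Part 4 — port of `Summits/ResolutionOfSingularities/ResolutionOfSingularities/Theorems/WeightedInvariantContactFiltrationCanonical.lean`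

# The contact filtration of a regular parameter and its canonicity (door `HypersurfaceCentreConstruction`, rung P2)

Topic: `Summits/ResolutionOfSingularities/ResolutionOfSingularities/Theorems`. Helper for the door item
`HypersurfaceCentreConstruction` (statement `stmt-ResolutionOfSingularities-19897`, route `WeightedInvariant`),
line `local-engine` of `res-L1-w43-plan-1` (L W4.3), CRUX-PLAN §v7.2 position rung **P2** («positions of dimension ≤ 2
with ONE explicit `(ι₂, J₂) = (iotaOrd, TERMINAL-STEEPENING weighted filtration)`», order (o24) reserved; risk line
«canonicity of the terminal filtration under wild automorphisms in char p»).  This file is the J-HALF LEMMA of that rung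
BY NAME (the twin of res-type-073's ι-half `…IotaOrderStratDimTwo`): it settles the canonicity risk POSITIVELY and
fact-free for the filtrations that the (o13) dim-2 rung (K3–K7) actually uses.  Reserve hand res-type-078 (OFFER +
TAKING-UNLESS-OBJECTED 2026-08-27T07:34:56Z; counted 0; does not pre-empt (o24)).

[OURS · L1 W4.3] Replaces the role of NO printed item; NOT a statement of the manuscript
[claim: Hironaka2017, status: under-review]. AI work, weaker than expert review.

## Content (no definitions: the CONTACT FILTRATION of `g ∈ 𝔪` with weight `b` is written out as
`⨆ j, (g^j) · 𝔪^{n - b j}` — «the monomials `x^i g^j` with `i + b j ≥ n`» without naming `x`)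

* C1 `weightedMonomialIdeal_eq_contactFiltration`: for `(x, g) = 𝔪`, `b ≥ 1`: `weightedMonomialIdeal ![x, g] ![1, b] n =
  ⨆ j, (g^j) 𝔪^{n - bj}` — the `(1,b)`-filtration of the (o13) game does not depend on the transversal parameter `x`.
* C2 **`contactFiltration_eq_of_mem` (CANONICITY)**: in a regular local ring of ANY dimension, if `b ≥ 2`, `f ∉ 𝔪^{ν+1}`,
  `g₁, g₂ ∈ 𝔪 ∖ 𝔪²` and `f` lies in level `bν` of BOTH contact filtrations, they coincide in every degree (key step
  `mem_span_sup_pow_of_mem_contactFiltration`: `g₁ ∈ (g₂) + 𝔪^b`, reading `f` in the regular local ring `S/(g₂)` where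
  `unit · g₁^ν` has order `ν · ord ḡ₁` strictly below every other term unless `ord ḡ₁ ≥ b`).
* C3 `weightedMonomialIdeal_eq_of_mem_of_mem`: the TERMINAL filtration of the steepening process (`…EFTDimTwoSteepening`,
  `…EFTDimTwoContact`) at a dimension-two position is independent of `x`, of the lifts `λ̃`, and of the terminal contact
  parameter — the candidate `J₂(S, f)` of P2 is choice-free; `b = 1` is the `𝔪`-adic filtration
  (`contactFiltration_one_eq_pow`); unit / iso invariance in the `JUnitInvariant` / `JIsoInvariant` shapes
  (`unit_mul_mem_iff`, `contactFiltration_unit_mul`, `map_contactFiltration_ringEquiv`).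

## References

* H. Hironaka, *Characteristic polyhedra of singularities*, J. Math. Kyoto Univ. 7 (1967) 251–293. [Hironaka1967]
* V. Cossart, O. Piltant, *Resolution of singularities of arithmetical threefolds II*, §2. [CossartPiltant2019]
-/

section Part4


open _root_.IsLocalRing _root_.Literature.AlgebraicGeometry.Resolution

namespace Literature.AlgebraicGeometry.Resolution.WeightedInvariant

namespace ContactFiltration

universe u

variable {S : Type u} [CommRing S]

/-! ### The contact filtration `⨆ j, (g^j) 𝔪^{n - bj}`: elementary inclusions -/

section Basic

variable [IsLocalRing S]

/-- The `j`-th piece lies in the filtration. [folklore] -/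
private theorem piece_le (g : S) (b n j : ℕ) :
    Ideal.span {g ^ j} * maximalIdeal S ^ (n - b * j) ≤
      ⨆ j, Ideal.span {g ^ j} * maximalIdeal S ^ (n - b * j) :=
  le_iSup (fun j => Ideal.span {g ^ j} * maximalIdeal S ^ (n - b * j)) j

/-- `g^j · m` with `m ∈ 𝔪^{n - bj}` lies in degree `n`. [folklore] -/
private theorem pow_mul_mem (g : S) (b n j : ℕ) {m : S} (hm : m ∈ maximalIdeal S ^ (n - b * j)) :
    g ^ j * m ∈ ⨆ j, Ideal.span {g ^ j} * maximalIdeal S ^ (n - b * j) :=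
  piece_le g b n j (Ideal.mul_mem_mul (Ideal.mem_span_singleton_self _) hm)

/-- `𝔪^n` lies in degree `n` (the piece `j = 0`). [folklore] -/
private theorem pow_le (g : S) (b n : ℕ) :
    maximalIdeal S ^ n ≤ ⨆ j, Ideal.span {g ^ j} * maximalIdeal S ^ (n - b * j) := by
  have h := piece_le g b n 0
  rwa [pow_zero, Ideal.span_singleton_one, Ideal.top_mul, mul_zero, Nat.sub_zero] at h

/-- Degree `n` lies in `(g) + 𝔪^n` (the pieces `j ≥ 1` are multiples of `g`). [folklore] -/
private theorem le_span_sup_pow (g : S) (b n : ℕ) :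
    (⨆ j, Ideal.span {g ^ j} * maximalIdeal S ^ (n - b * j)) ≤ Ideal.span {g} ⊔ maximalIdeal S ^ n := by
  refine iSup_le fun j => ?_
  rcases Nat.eq_zero_or_pos j with rfl | hj
  · rw [pow_zero, Ideal.span_singleton_one, Ideal.top_mul, mul_zero, Nat.sub_zero]
    exact le_sup_right
  · refine le_trans Ideal.mul_le_right (le_trans ?_ le_sup_left)
    rw [Ideal.span_singleton_le_iff_mem, Ideal.mem_span_singleton]
    exact dvd_pow_self g hj.ne'

/-- For `b = 1` (and `g ∈ 𝔪`) the contact filtration is the `𝔪`-adic one. [folklore] -/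
private theorem contactFiltration_one_eq_pow {g : S} (hg : g ∈ maximalIdeal S) (n : ℕ) :
    (⨆ j, Ideal.span {g ^ j} * maximalIdeal S ^ (n - 1 * j)) = maximalIdeal S ^ n := by
  refine le_antisymm (iSup_le fun j => ?_) (pow_le g 1 n)
  rw [one_mul]
  have hgj : Ideal.span {g ^ j} ≤ maximalIdeal S ^ j := by
    rw [Ideal.span_singleton_le_iff_mem]
    exact Ideal.pow_mem_pow hg j
  refine le_trans (Ideal.mul_mono_left hgj) ?_
  rw [← pow_add]
  exact Ideal.pow_le_pow_right (by omega)

/-- UNIT INVARIANCE in the equation (`JUnitInvariant` shape of `…LocalGameEFT3`): `v f` and `f` lie in the same pieces.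
[folklore] -/
private theorem unit_mul_mem_iff {v : S} (hv : IsUnit v) (f g : S) (b n : ℕ) :
    v * f ∈ (⨆ j, Ideal.span {g ^ j} * maximalIdeal S ^ (n - b * j)) ↔
      f ∈ ⨆ j, Ideal.span {g ^ j} * maximalIdeal S ^ (n - b * j) :=
  Ideal.unit_mul_mem_iff_mem _ hv

/-- UNIT INVARIANCE in the contact parameter: `v g` and `g` have the same contact filtration. [folklore] -/
private theorem contactFiltration_unit_mul {v : S} (hv : IsUnit v) (g : S) (b n : ℕ) :
    (⨆ j, Ideal.span {(v * g) ^ j} * maximalIdeal S ^ (n - b * j)) =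
      ⨆ j, Ideal.span {g ^ j} * maximalIdeal S ^ (n - b * j) := by
  refine iSup_congr fun j => ?_
  rw [mul_pow, Ideal.span_singleton_mul_left_unit (hv.pow j)]

/-- ISO INVARIANCE (`JIsoInvariant` shape of `…LocalGameEFT3`): a ring isomorphism of local rings transports the
contact filtration of `g` to that of `e g`. [folklore] -/
private theorem map_contactFiltration_ringEquiv {T : Type u} [CommRing T] [IsLocalRing T] (e : S ≃+* T) (g : S)
    (b n : ℕ) :
    (⨆ j, Ideal.span {g ^ j} * maximalIdeal S ^ (n - b * j)).map e.toRingHom =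
      ⨆ j, Ideal.span {e g ^ j} * maximalIdeal T ^ (n - b * j) := by
  rw [Ideal.map_iSup]
  refine iSup_congr fun j => ?_
  rw [Ideal.map_mul, Ideal.map_pow, Ideal.map_span, Set.image_singleton,
    IsLocalRing.map_maximalIdeal_of_surjective e.toRingHom e.surjective]
  simp

end Basic

/-! ### C1: the weighted filtration of an r.s.p. `(x, g)` is the contact filtration of `g` -/

section Chart

variable [IsLocalRing S]

/-- **C1**: for `(x, g) = 𝔪` and `b ≥ 1`, `weightedMonomialIdeal ![x, g] ![1, b] n = ⨆ j, (g^j) 𝔪^{n - bj}` — the weighted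
filtration of the (o13) game does not depend on the transversal parameter `x`. [cite: Hironaka1967, §1] -/
theorem weightedMonomialIdeal_eq_contactFiltration {x g : S} (hxg : Ideal.span {x, g} = maximalIdeal S) {b : ℕ}
    (hb : 1 ≤ b) (n : ℕ) :
    weightedMonomialIdeal ![x, g] ![1, b] n = ⨆ j, Ideal.span {g ^ j} * maximalIdeal S ^ (n - b * j) := by
  apply le_antisymm
  · rw [weightedMonomialIdeal, Ideal.span_le]
    rintro _ ⟨α, hα, rfl⟩
    simp only [Fin.sum_univ_two, Matrix.cons_val_zero, Matrix.cons_val_one, one_mul] at hα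
    rw [Fin.prod_univ_two]
    simp only [Matrix.cons_val_zero, Matrix.cons_val_one, SetLike.mem_coe]
    have hx : x ∈ maximalIdeal S := hxg ▸ Ideal.subset_span (by simp)
    rw [mul_comm]
    exact pow_mul_mem g b n (α 1) (Ideal.pow_le_pow_right (by omega) (Ideal.pow_mem_pow hx (α 0)))
  · refine iSup_le fun j => ?_
    have h1 : Ideal.span {g ^ j} ≤ weightedMonomialIdeal ![x, g] ![1, b] (b * j) := by
      rw [Ideal.span_singleton_le_iff_mem]
      simpa [Nat.mul_comm] using
        pow_mem_weightedMonomialIdeal ![x, g] ![1, b] (LocalGameEFTSteepening.snd_mem x g b) j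
    have h2 : maximalIdeal S ^ (n - b * j) ≤ weightedMonomialIdeal ![x, g] ![1, b] (n - b * j) := by
      rw [← hxg]
      exact LocalGameEFTSteepening.span_pair_pow_le x g hb _
    refine le_trans (Ideal.mul_mono h1 h2) (le_trans (weightedMonomialIdeal_mul_le ![x, g] ![1, b] _ _) ?_)
    exact weightedMonomialIdeal_antitone _ _ (by omega)

/-- **Independence of the transversal parameter**: two regular systems `(x₁, g)`, `(x₂, g)` with the same contact
parameter `g` define the same `(1, b)`-weighted filtration. [cite: Hironaka1967, §1] -/
theorem weightedMonomialIdeal_pair_eq_of_snd_eq {x₁ x₂ g : S} (h₁ : Ideal.span {x₁, g} = maximalIdeal S)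
    (h₂ : Ideal.span {x₂, g} = maximalIdeal S) {b : ℕ} (hb : 1 ≤ b) (n : ℕ) :
    weightedMonomialIdeal ![x₁, g] ![1, b] n = weightedMonomialIdeal ![x₂, g] ![1, b] n := by
  rw [weightedMonomialIdeal_eq_contactFiltration h₁ hb, weightedMonomialIdeal_eq_contactFiltration h₂ hb]

end Chart

/-! ### C2: canonicity of the contact filtration -/

section Canonical

variable [IsRegularLocalRing S]

/-- Comparison of two contact parameters: `g₁ ∈ (g₂) + 𝔪^b` transfers the filtration of `g₁` into that of `g₂`.
[folklore] -/
private theorem contactFiltration_le_of_mem_span_sup_pow {g₁ g₂ : S} {b : ℕ}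
    (h : g₁ ∈ Ideal.span {g₂} ⊔ maximalIdeal S ^ b) (n : ℕ) :
    (⨆ j, Ideal.span {g₁ ^ j} * maximalIdeal S ^ (n - b * j)) ≤
      ⨆ j, Ideal.span {g₂ ^ j} * maximalIdeal S ^ (n - b * j) := by
  -- `(g₁^j) ⊆ ⨆_{i ≤ j} (g₂^i) 𝔪^{b(j-i)}`
  have hpow : ∀ j : ℕ, Ideal.span {g₁ ^ j} ≤ ⨆ i, Ideal.span {g₂ ^ i} * maximalIdeal S ^ (b * j - b * i) := by
    intro j
    induction j with
    | zero =>
      refine le_trans ?_ (le_iSup (fun i => Ideal.span {g₂ ^ i} * maximalIdeal S ^ (b * 0 - b * i)) 0)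
      simp
    | succ j ih =>
      have hg₁ : Ideal.span {g₁} ≤ Ideal.span {g₂} ⊔ maximalIdeal S ^ b := by
        rwa [Ideal.span_singleton_le_iff_mem]
      rw [pow_succ, ← Ideal.span_singleton_mul_span_singleton]
      refine le_trans (Ideal.mul_mono ih hg₁) ?_
      rw [Ideal.iSup_mul]
      refine iSup_le fun i => ?_
      rw [Ideal.mul_sup]
      refine sup_le ?_ ?_
      · -- `(g₂^i) 𝔪^{bj-bi} · (g₂) ⊆ (g₂^{i+1}) 𝔪^{b(j+1) - b(i+1)}`
        refine le_trans ?_ (le_iSup (fun i => Ideal.span {g₂ ^ i} * maximalIdeal S ^ (b * (j + 1) - b * i)) (i + 1))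
        rw [mul_right_comm, Ideal.span_singleton_mul_span_singleton, ← pow_succ]
        exact Ideal.mul_mono_right (Ideal.pow_le_pow_right (by
          simp only [Nat.mul_succ]
          omega))
      · -- `(g₂^i) 𝔪^{bj-bi} · 𝔪^b ⊆ (g₂^i) 𝔪^{b(j+1) - bi}`
        refine le_trans ?_ (le_iSup (fun i => Ideal.span {g₂ ^ i} * maximalIdeal S ^ (b * (j + 1) - b * i)) i)
        rw [mul_assoc, ← pow_add]
        exact Ideal.mul_mono_right (Ideal.pow_le_pow_right (by
          simp only [Nat.mul_succ]
          omega))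
  refine iSup_le fun j => ?_
  refine le_trans (Ideal.mul_mono_left (hpow j)) ?_
  rw [Ideal.iSup_mul]
  refine iSup_le fun i => le_trans ?_ (piece_le g₂ b n i)
  rw [mul_assoc, ← pow_add]
  exact Ideal.mul_mono_right (Ideal.pow_le_pow_right (by omega))

/-- Powers in a regular local ring: `a ∉ 𝔪^{t+1}` implies `a^ν ∉ 𝔪^{νt+1}` (the order is a valuation).
[cite: ZariskiSamuel1960, Ch. VIII §1 Thm. 1] -/
theorem pow_not_mem_pow_of_not_mem_pow {a : S} {t : ℕ} (ha : a ∉ maximalIdeal S ^ (t + 1)) (ν : ℕ) :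
    a ^ ν ∉ maximalIdeal S ^ (ν * t + 1) := by
  induction ν with
  | zero =>
    rw [pow_zero, zero_mul, zero_add, pow_one]
    exact fun h => (IsLocalRing.maximalIdeal.isMaximal S).ne_top (Ideal.eq_top_of_isUnit_mem _ h isUnit_one)
  | succ ν ih =>
    have h := mul_not_mem_pow_of_not_mem_pow ih ha
    rw [show (ν + 1) * t + 1 = ν * t + t + 1 by ring, pow_succ a ν]
    exact h

/-- **Key step of C2**: let `S` be a regular local ring, `b ≥ 2`, `1 ≤ ν`, `f ∉ 𝔪^{ν+1}`, `g₁ ∈ 𝔪`, `g₂ ∈ 𝔪 ∖ 𝔪²`, and suppose `f`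
lies in degree `bν` of the contact filtrations of BOTH `g₁` and `g₂`.  Then `g₁ ∈ (g₂) + 𝔪^b`.
Proof: in the regular local ring `D = S/(g₂)`, `f̄ ∈ 𝔪_D^{bν}`; writing `f = c g₁^ν + f'` with `c` a unit (forced by
`f ∉ 𝔪^{ν+1}`, `b ≥ 2`) and `f'` in the lower pieces, if `t = ord_D(ḡ₁) < b` then every term of `f̄'` has order
`≥ tν + 1` while `c̄ ḡ₁^ν` has order exactly `tν < bν` — impossible. [cite: Hironaka1967, Thm. (well-preparedness)] -/
theorem mem_span_sup_pow_of_mem_contactFiltration {g₁ g₂ : S} (hg₁ : g₁ ∈ maximalIdeal S)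
    (hg₂ : g₂ ∈ maximalIdeal S) (hg₂' : g₂ ∉ maximalIdeal S ^ 2) {b : ℕ} (hb : 2 ≤ b) {f : S} {ν : ℕ} (hν : 1 ≤ ν)
    (hford : f ∉ maximalIdeal S ^ (ν + 1))
    (h₁ : f ∈ ⨆ j, Ideal.span {g₁ ^ j} * maximalIdeal S ^ (b * ν - b * j))
    (h₂ : f ∈ ⨆ j, Ideal.span {g₂ ^ j} * maximalIdeal S ^ (b * ν - b * j)) :
    g₁ ∈ Ideal.span {g₂} ⊔ maximalIdeal S ^ b := by
  classical
  -- the quotient `D = S/(g₂)`, a regular local ring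
  haveI hD : IsRegularLocalRing (S ⧸ Ideal.span {g₂}) := (IsRegularLocalRing.quotient_span_singleton hg₂ hg₂').1
  set mk : S →+* S ⧸ Ideal.span {g₂} := Ideal.Quotient.mk (Ideal.span {g₂}) with hmk
  have hmkmax : (maximalIdeal S).map mk = maximalIdeal (S ⧸ Ideal.span {g₂}) :=
    IsLocalRing.map_maximalIdeal_of_surjective mk Ideal.Quotient.mk_surjective
  have hcomap : ∀ k : ℕ, (maximalIdeal (S ⧸ Ideal.span {g₂}) ^ k).comap mk = Ideal.span {g₂} ⊔ maximalIdeal S ^ k :=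
    fun k => by
      rw [← hmkmax, ← Ideal.map_pow, Ideal.comap_map_of_surjective mk Ideal.Quotient.mk_surjective,
        ← RingHom.ker_eq_comap_bot, hmk, Ideal.mk_ker, sup_comm]
  -- if `g₁ ∈ (g₂)` we are done
  by_cases hzero : mk g₁ = 0
  · rw [Ideal.Quotient.eq_zero_iff_mem] at hzero
    exact Ideal.mem_sup_left hzero
  -- the order `t` of `ḡ₁`
  obtain ⟨t, ht⟩ := ENat.ne_top_iff_exists.mp (adicOrder_ne_top hzero)
  have htmem : mk g₁ ∈ maximalIdeal (S ⧸ Ideal.span {g₂}) ^ t := (le_adicOrder_iff _ _).mp ht.le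
  have htnot : mk g₁ ∉ maximalIdeal (S ⧸ Ideal.span {g₂}) ^ (t + 1) := (adicOrder_le_iff _ _).mp ht.ge
  by_cases htb : b ≤ t
  · rw [← hcomap b, Ideal.mem_comap]
    exact Ideal.pow_le_pow_right htb htmem
  exfalso
  push Not at htb
  -- `f = a + f'`, `a ∈ (g₁^ν)`, `f'` in the lower pieces `I'`
  set I' : Ideal S := (⨆ j, ⨆ (_ : j < ν), Ideal.span {g₁ ^ j} * maximalIdeal S ^ (b * ν - b * j)) ⊔
    Ideal.span {g₁ ^ ν} * maximalIdeal S with hI'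
  have hsplit : (⨆ j, Ideal.span {g₁ ^ j} * maximalIdeal S ^ (b * ν - b * j)) ≤ Ideal.span {g₁ ^ ν} ⊔ I' := by
    refine iSup_le fun j => ?_
    by_cases hj : j < ν
    · refine le_trans ?_ le_sup_right
      rw [hI']
      refine le_trans ?_ le_sup_left
      exact le_trans (le_iSup (fun _ : j < ν => Ideal.span {g₁ ^ j} * maximalIdeal S ^ (b * ν - b * j)) hj)
        (le_iSup (fun j => ⨆ (_ : j < ν), Ideal.span {g₁ ^ j} * maximalIdeal S ^ (b * ν - b * j)) j)
    · push Not at hj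
      refine le_trans Ideal.mul_le_right (le_trans ?_ le_sup_left)
      rw [Ideal.span_singleton_le_iff_mem, Ideal.mem_span_singleton]
      exact pow_dvd_pow g₁ hj
  have hI'le : I' ≤ maximalIdeal S ^ (ν + 1) := by
    rw [hI']
    refine sup_le (iSup_le fun j => iSup_le fun hj => ?_) ?_
    · have h1 : Ideal.span {g₁ ^ j} ≤ maximalIdeal S ^ j := by
        rw [Ideal.span_singleton_le_iff_mem]; exact Ideal.pow_mem_pow hg₁ j
      refine le_trans (Ideal.mul_mono_left h1) ?_
      rw [← pow_add]
      refine Ideal.pow_le_pow_right ?_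
      have e1 : b * ν - b * j = b * (ν - j) := (mul_tsub b ν j).symm
      have e2 : 2 * (ν - j) ≤ b * (ν - j) := Nat.mul_le_mul_right _ hb
      rw [e1]
      omega
    · have h1 : Ideal.span {g₁ ^ ν} ≤ maximalIdeal S ^ ν := by
        rw [Ideal.span_singleton_le_iff_mem]; exact Ideal.pow_mem_pow hg₁ ν
      refine le_trans (Ideal.mul_mono_left h1) ?_
      rw [pow_succ]
  obtain ⟨a, ha, f', hf', haf⟩ := Submodule.mem_sup.mp (hsplit h₁)
  obtain ⟨c, rfl⟩ := Ideal.mem_span_singleton'.mp ha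
  -- `c` is a unit
  have hc : IsUnit c := by
    by_contra hcu
    have hcm : c ∈ maximalIdeal S := (IsLocalRing.mem_maximalIdeal _).mpr hcu
    apply hford
    rw [← haf]
    refine Ideal.add_mem _ ?_ (hI'le hf')
    have : c * g₁ ^ ν ∈ Ideal.span {g₁ ^ ν} * maximalIdeal S :=
      Submodule.mul_mem_mul_rev (Ideal.mem_span_singleton_self _) hcm
    exact hI'le (by rw [hI']; exact Ideal.mem_sup_right this)
  -- in `D`: `f̄ ∈ 𝔪_D^{bν} ⊆ 𝔪_D^{tν+1}` and `f̄' ∈ 𝔪_D^{tν+1}`, hence `c̄ ḡ₁^ν ∈ 𝔪_D^{tν+1}` — contradiction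
  have htν : ν * t + 1 ≤ b * ν := by
    have := Nat.mul_le_mul_left ν htb
    rw [Nat.mul_succ] at this
    rw [Nat.mul_comm b]
    omega
  have hfD : mk f ∈ maximalIdeal (S ⧸ Ideal.span {g₂}) ^ (ν * t + 1) := by
    refine Ideal.pow_le_pow_right htν ?_
    rw [← Ideal.mem_comap, hcomap]
    exact le_span_sup_pow g₂ b (b * ν) (by simpa [Nat.mul_comm] using h₂)
  have hI'D : I'.map mk ≤ maximalIdeal (S ⧸ Ideal.span {g₂}) ^ (ν * t + 1) := by
    rw [hI', Ideal.map_sup, Ideal.map_iSup]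
    refine sup_le (iSup_le fun j => ?_) ?_
    · rw [Ideal.map_iSup]
      refine iSup_le fun hj => ?_
      rw [Ideal.map_mul, Ideal.map_pow, hmkmax, Ideal.map_span, Set.image_singleton, map_pow]
      have h1 : Ideal.span {mk g₁ ^ j} ≤ maximalIdeal (S ⧸ Ideal.span {g₂}) ^ (t * j) := by
        rw [Ideal.span_singleton_le_iff_mem, pow_mul]
        exact Ideal.pow_mem_pow htmem j
      refine le_trans (Ideal.mul_mono_left h1) ?_
      rw [← pow_add]
      refine Ideal.pow_le_pow_right ?_
      -- `t j + b(ν - j) ≥ t j + (t+1)(ν - j) = t ν + (ν - j) ≥ ν t + 1`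
      have e1 : b * ν - b * j = b * (ν - j) := (mul_tsub b ν j).symm
      have h3 : (t + 1) * (ν - j) ≤ b * (ν - j) := Nat.mul_le_mul_right _ htb
      have h4 : t * j + t * (ν - j) = t * ν := by rw [← Nat.mul_add, Nat.add_sub_cancel' hj.le]
      have h5 : (t + 1) * (ν - j) = t * (ν - j) + (ν - j) := by ring
      have h6 : ν * t = t * ν := Nat.mul_comm _ _
      rw [e1]
      omega
    · rw [Ideal.map_mul, hmkmax, Ideal.map_span, Set.image_singleton, map_pow, pow_succ]
      refine Ideal.mul_mono_left ?_
      rw [Ideal.span_singleton_le_iff_mem, Nat.mul_comm, pow_mul]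
      exact Ideal.pow_mem_pow htmem ν
  have hcg : mk (c * g₁ ^ ν) ∈ maximalIdeal (S ⧸ Ideal.span {g₂}) ^ (ν * t + 1) := by
    have : mk (c * g₁ ^ ν) = mk f - mk f' := by rw [← haf, map_add, add_sub_cancel_right]
    rw [this]
    exact Ideal.sub_mem _ hfD (hI'D (Ideal.mem_map_of_mem mk hf'))
  have hgν : mk g₁ ^ ν ∈ maximalIdeal (S ⧸ Ideal.span {g₂}) ^ (ν * t + 1) := by
    rw [map_mul, map_pow] at hcg
    obtain ⟨u, hu⟩ := hc.map mk
    have := Ideal.mul_mem_left _ (↑u⁻¹ : S ⧸ Ideal.span {g₂}) hcg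
    rwa [← mul_assoc, ← hu, Units.inv_mul, one_mul] at this
  exact pow_not_mem_pow_of_not_mem_pow htnot ν hgν

/-- **C2 — CANONICITY OF THE CONTACT FILTRATION**: in a regular local ring `S` (any dimension), let `b ≥ 2`, `1 ≤ ν`,
`f ∉ 𝔪^{ν+1}`, and `g₁, g₂ ∈ 𝔪 ∖ 𝔪²` two contact parameters which both carry `f` to level `bν`
(`f ∈ ⨆ j, (g_i^j) 𝔪^{bν - bj}`, `i = 1, 2`).  Then the two contact filtrations agree in EVERY degree.
[cite: Hironaka1967, Thm. (well-preparedness)] [cite: CossartPiltant2019, §2] -/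
theorem contactFiltration_eq_of_mem {g₁ g₂ : S} (hg₁ : g₁ ∈ maximalIdeal S) (hg₁' : g₁ ∉ maximalIdeal S ^ 2)
    (hg₂ : g₂ ∈ maximalIdeal S) (hg₂' : g₂ ∉ maximalIdeal S ^ 2) {b : ℕ} (hb : 2 ≤ b) {f : S} {ν : ℕ}
    (hν : 1 ≤ ν) (hford : f ∉ maximalIdeal S ^ (ν + 1))
    (h₁ : f ∈ ⨆ j, Ideal.span {g₁ ^ j} * maximalIdeal S ^ (b * ν - b * j))
    (h₂ : f ∈ ⨆ j, Ideal.span {g₂ ^ j} * maximalIdeal S ^ (b * ν - b * j)) (n : ℕ) :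
    (⨆ j, Ideal.span {g₁ ^ j} * maximalIdeal S ^ (n - b * j)) =
      ⨆ j, Ideal.span {g₂ ^ j} * maximalIdeal S ^ (n - b * j) :=
  le_antisymm
    (contactFiltration_le_of_mem_span_sup_pow
      (mem_span_sup_pow_of_mem_contactFiltration hg₁ hg₂ hg₂' hb hν hford h₁ h₂) n)
    (contactFiltration_le_of_mem_span_sup_pow
      (mem_span_sup_pow_of_mem_contactFiltration hg₂ hg₁ hg₁' hb hν hford h₂ h₁) n)

/-- **C3 — the terminal weighted filtration of the dimension-two game is choice-free**: two regular systems of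
parameters `(x₁, y₁)`, `(x₂, y₂)` of a two-dimensional regular local ring which both carry `f` (`f ∉ 𝔪^{ν+1}`, `ν ≥ 1`)
to the same level `b ≥ 2` of their `(1, b)`-weighted filtrations define the SAME filtration:
`weightedMonomialIdeal ![x₁, y₁] ![1, b] = weightedMonomialIdeal ![x₂, y₂] ![1, b]`.  So the candidate `J₂(S, f)` of rung
P2 — the filtration at the maximal level reached by any contact parameter — involves no choice of coordinates or of
lifts in the steepening process. [cite: Hironaka1967, Thm. (well-preparedness)] -/
theorem weightedMonomialIdeal_eq_of_mem_of_mem (hdim : ringKrullDim S = (2 : ℕ)) {x₁ y₁ x₂ y₂ : S}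
    (h₁ : Ideal.span {x₁, y₁} = maximalIdeal S) (h₂ : Ideal.span {x₂, y₂} = maximalIdeal S) {b : ℕ} (hb : 2 ≤ b)
    {f : S} {ν : ℕ} (hν : 1 ≤ ν) (hford : f ∉ maximalIdeal S ^ (ν + 1))
    (hf₁ : f ∈ weightedMonomialIdeal ![x₁, y₁] ![1, b] (b * ν))
    (hf₂ : f ∈ weightedMonomialIdeal ![x₂, y₂] ![1, b] (b * ν)) (n : ℕ) :
    weightedMonomialIdeal ![x₁, y₁] ![1, b] n = weightedMonomialIdeal ![x₂, y₂] ![1, b] n := by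
  have hb1 : 1 ≤ b := by omega
  have hy₁ : y₁ ∈ maximalIdeal S := h₁ ▸ Ideal.subset_span (by simp)
  have hy₂ : y₂ ∈ maximalIdeal S := h₂ ▸ Ideal.subset_span (by simp)
  have hy₁' := (LocalGameEFTSteepening.not_mem_sq_of_span_pair_eq hdim h₁).2
  have hy₂' := (LocalGameEFTSteepening.not_mem_sq_of_span_pair_eq hdim h₂).2
  rw [weightedMonomialIdeal_eq_contactFiltration h₁ hb1] at hf₁
  rw [weightedMonomialIdeal_eq_contactFiltration h₂ hb1] at hf₂
  rw [weightedMonomialIdeal_eq_contactFiltration h₁ hb1, weightedMonomialIdeal_eq_contactFiltration h₂ hb1]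
  exact contactFiltration_eq_of_mem hy₁ hy₁' hy₂ hy₂' hb hν hford hf₁ hf₂ n

end Canonical

end ContactFiltration

end Literature.AlgebraicGeometry.Resolution.WeightedInvariant

end Part4

/-!
## Part 5 — port of `Summits/ResolutionOfSingularities/ResolutionOfSingularities/Theorems/AQSHeightTwoWeightedContactUnique.lean`

# (o25-α) support: Abramovich–Quek–Schober Thm 3.5 (a)(b)(c) at general weights — the filtration of a weighted centre with `w₁ ≤ w₀`
# does not depend on the transversal parameter, and two admissible regular systems at the same `(w, ℓ)` define the SAME filtration

Topic: `Summits/ResolutionOfSingularities/ResolutionOfSingularities/Theorems`. Helper for the door item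
`HypersurfaceCentreConstruction` (statement `stmt-ResolutionOfSingularities-19897`, route `WeightedInvariant`), ORDER (o25)
«F-AQS-T in the kernel» (lead res-type-092, design memo `plan/tools/res-type-092/o25/O25-DESIGN.md`; (o25-α) support by the
co-hand res-type-070, INPUT #2 HOME/STATUS 2026-08-27T09:37Z).  Def-free; the tree's currency for the centre `(y^{a₁}, x^{a₂})` with
reduced weights `(w 0, w 1)`, `w 1 ≤ w 0`, is `weightedMonomialIdeal ![y, x] w n` (index `0` = the ORDER / contact parameter).

* (U1) `weightedMonomialIdeal_pair_le_of_mem_span`, `weightedMonomialIdeal_pair_eq_of_span_eq` — for `w 1 ≤ w 0` the filtration does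
  not depend on the transversal parameter: `(x₀, x₁) = (x₀, z)` ⇒ equal filtrations (expand `x₁ = a x₀ + c z` binomially; the weight only
  grows).  Generalises res-type-078's C1 (`ContactFiltration.weightedMonomialIdeal_eq_contactFiltration`, slope `w = (b, 1)`).
* (U2) `mem_span_sup_pow_of_mem_weightedMonomialIdeal` — THE KEY STEP AT WEIGHTS (C2's `mem_span_sup_pow_of_mem_contactFiltration`
  re-run with rational slope `s = w 0 / w 1 > 1`): in a regular local ring, if `f ∉ 𝔪^{ν+1}` is admissible at the level `ℓ = w 0 · ν` for
  both `(g₁, x₁)` and `(g₂, x₂)` (`gᵢ, xᵢ ∈ 𝔪`, `g₂ ∉ 𝔪²`) then `g₁ ∈ (g₂) + 𝔪^m` for every `m` with `w 1 (m − 1) < w 0` — the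
  discrete-valuation argument in `S/(g₂)` (AQS Thm 3.5 proof (b), without monomial valuations or unit expansions).
* (U3) `weightedMonomialIdeal_le_of_mem_span_sup_pow` — `g₁ ∈ (g₂) + 𝔪^m` with `w 0 ≤ w 1 m` and `x₁ ∈ 𝔪 = (g₂, x₂)` ⇒
  `𝒥((g₁, x₁)) ≤ 𝒥((g₂, x₂))` (multiplicativity `weightedMonomialIdeal_mul_le`).
* **`weightedMonomialIdeal_eq_of_admissible`** — AQS Thm 3.5 proof (c): two regular systems of parameters both admissible at the same
  `(w, w 0 · ν)` with `0 < w 1 < w 0` define the SAME filtration in every degree = clause 9 (UNIQUE) of `IsLexMaxWeightedCentreGerm`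
  (`Literature/…/HypersurfaceHeightTwoWeightedCentre.lean`); no lex-maximality is needed.  (Slope `1`, i.e. `w = (1,1)` after reduction,
  is the `𝔪`-adic filtration — independent of the parameters outright.)

[OURS · L1 W4.3] Replaces the role of NO printed item; NOT a statement of the manuscript
[claim: Hironaka2017, status: under-review]. AI work, weaker than expert review.
-/

section Part5


open _root_.IsLocalRing _root_.Literature.AlgebraicGeometry.Resolution

namespace Literature.AlgebraicGeometry.Resolution.WeightedInvariant

namespace AQSHeightTwo

universe u

variable {S : Type u} [CommRing S]

/-- The monomial `x₀^i z^j` lies in `weightedMonomialIdeal ![x₀, z] w n` as soon as `w 0 i + w 1 j ≥ n`. [folklore] -/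
private theorem pow_mul_pow_mem_weightedMonomialIdeal (x₀ z : S) (w : Fin 2 → ℕ) {i j n : ℕ} (h : n ≤ w 0 * i + w 1 * j) :
    x₀ ^ i * z ^ j ∈ weightedMonomialIdeal ![x₀, z] w n := by
  refine Ideal.subset_span ⟨![i, j], ?_, ?_⟩
  · simpa [Fin.sum_univ_two] using h
  · simp [Fin.prod_univ_two]

/-- **(U1) Transversal independence, one inclusion**: if `w 1 ≤ w 0` and `x₁ ∈ (x₀, z)` then
`weightedMonomialIdeal ![x₀, x₁] w n ≤ weightedMonomialIdeal ![x₀, z] w n` (write `x₁ = a x₀ + c z` and expand binomially: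
`x₀^{α₀} x₁^{α₁}` is a combination of `x₀^{α₀ + k} z^{α₁ - k}`, of weight `w 0 (α₀ + k) + w 1 (α₁ - k) ≥ w 0 α₀ + w 1 α₁`).
[cite: AbramovichQuekSchober2025, Thm 3.5 proof (a)] -/
theorem weightedMonomialIdeal_pair_le_of_mem_span (x₀ x₁ z : S) (w : Fin 2 → ℕ) (hw : w 1 ≤ w 0)
    (hx₁ : x₁ ∈ Ideal.span {x₀, z}) (n : ℕ) :
    weightedMonomialIdeal ![x₀, x₁] w n ≤ weightedMonomialIdeal ![x₀, z] w n := by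
  classical
  obtain ⟨a, c, hac⟩ := Ideal.mem_span_pair.mp hx₁
  rw [weightedMonomialIdeal, Ideal.span_le]
  rintro _ ⟨α, hα, rfl⟩
  rw [Fin.sum_univ_two] at hα
  simp only [SetLike.mem_coe, Fin.prod_univ_two, Matrix.cons_val_zero, Matrix.cons_val_one]
  rw [← hac, add_pow, Finset.mul_sum]
  refine Ideal.sum_mem _ fun k hk => ?_
  have hkle : k ≤ α 1 := Nat.lt_succ_iff.mp (Finset.mem_range.mp hk)
  have hmem : x₀ ^ (α 0 + k) * z ^ (α 1 - k) ∈ weightedMonomialIdeal ![x₀, z] w n :=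
    pow_mul_pow_mem_weightedMonomialIdeal x₀ z w (by
      have h1 : w 1 * (α 1 - k) + w 1 * k = w 1 * α 1 := by rw [← Nat.mul_add, Nat.sub_add_cancel hkle]
      have h2 : w 1 * k ≤ w 0 * k := Nat.mul_le_mul_right k hw
      nlinarith [hα, h1, h2])
  have heq : x₀ ^ α 0 * ((a * x₀) ^ k * (c * z) ^ (α 1 - k) * ((α 1).choose k : S)) =
      (a ^ k * c ^ (α 1 - k) * ((α 1).choose k : S)) * (x₀ ^ (α 0 + k) * z ^ (α 1 - k)) := by
    rw [mul_pow, mul_pow, pow_add]; ring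
  rw [heq]
  exact Ideal.mul_mem_left _ _ hmem

/-- **(U1) The filtration of a weighted centre with `w 1 ≤ w 0` depends only on the contact parameter**: if
`(x₀, x₁) = (x₀, z)` as ideals then `weightedMonomialIdeal ![x₀, x₁] w = weightedMonomialIdeal ![x₀, z] w`.
[cite: AbramovichQuekSchober2025, Thm 3.5 proof (a)] -/
theorem weightedMonomialIdeal_pair_eq_of_span_eq (x₀ x₁ z : S) (w : Fin 2 → ℕ) (hw : w 1 ≤ w 0)
    (h : Ideal.span {x₀, x₁} = Ideal.span {x₀, z}) (n : ℕ) :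
    weightedMonomialIdeal ![x₀, x₁] w n = weightedMonomialIdeal ![x₀, z] w n :=
  le_antisymm
    (weightedMonomialIdeal_pair_le_of_mem_span x₀ x₁ z w hw (h ▸ Ideal.subset_span (by simp)) n)
    (weightedMonomialIdeal_pair_le_of_mem_span x₀ z x₁ w hw (h.symm ▸ Ideal.subset_span (by simp)) n)

/-! ### (U2) The key step at weights: two contact parameters admissible at the same `(w, ℓ)` are congruent mod `𝔪^⌈w₀/w₁⌉` -/

section KeyStep

variable [IsRegularLocalRing S]

/-- **(U2) Key step at weights** (res-type-078's C2 `ContactFiltration.mem_span_sup_pow_of_mem_contactFiltration` re-run with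
rational slope `s = w 0 / w 1 > 1`).  `S` regular local, `g₁, x₁, g₂, x₂ ∈ 𝔪` with `g₂ ∉ 𝔪²`, `w 1 < w 0`, `1 ≤ ν`,
`f ∉ 𝔪^{ν+1}`, and `f` admissible for BOTH weighted data at the level `ℓ = w 0 · ν`:
`f ∈ weightedMonomialIdeal ![g₁, x₁] w ℓ` and `f ∈ weightedMonomialIdeal ![g₂, x₂] w ℓ`.  Then `g₁ ∈ (g₂) + 𝔪^m` for every `m`
with `w 1 (m − 1) < w 0` (i.e. `m ≤ ⌈s⌉`).  Proof in the discrete valuation ring `D = S/(g₂)`: the coefficient `c` of `g₁^ν` is a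
unit (`s > 1`), `f̄ ∈ 𝔪_D^{i}` with `w 1 i ≥ ℓ`, and if `t = ord_D(ḡ₁)` has `w 1 t < w 0` every other term has order `> ν t` —
impossible. [cite: AbramovichQuekSchober2025, Thm 3.5 proof (b)] -/
theorem mem_span_sup_pow_of_mem_weightedMonomialIdeal {g₁ x₁ g₂ x₂ : S} (hg₁ : g₁ ∈ maximalIdeal S)
    (hx₁ : x₁ ∈ maximalIdeal S) (hg₂ : g₂ ∈ maximalIdeal S) (hg₂' : g₂ ∉ maximalIdeal S ^ 2) (hx₂ : x₂ ∈ maximalIdeal S)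
    (w : Fin 2 → ℕ) (hs : w 1 < w 0) {f : S} {ν : ℕ} (hν : 1 ≤ ν)
    (hford : f ∉ maximalIdeal S ^ (ν + 1)) (h₁ : f ∈ weightedMonomialIdeal ![g₁, x₁] w (w 0 * ν))
    (h₂ : f ∈ weightedMonomialIdeal ![g₂, x₂] w (w 0 * ν)) {m : ℕ} (hm : w 1 * (m - 1) < w 0) :
    g₁ ∈ Ideal.span {g₂} ⊔ maximalIdeal S ^ m := by
  classical
  -- the quotient `D = S/(g₂)`, a regular local ring
  haveI hD : IsRegularLocalRing (S ⧸ Ideal.span {g₂}) := (IsRegularLocalRing.quotient_span_singleton hg₂ hg₂').1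
  set mk : S →+* S ⧸ Ideal.span {g₂} := Ideal.Quotient.mk (Ideal.span {g₂}) with hmk
  have hmkmax : (maximalIdeal S).map mk = maximalIdeal (S ⧸ Ideal.span {g₂}) :=
    IsLocalRing.map_maximalIdeal_of_surjective mk Ideal.Quotient.mk_surjective
  have hcomap : ∀ k : ℕ, (maximalIdeal (S ⧸ Ideal.span {g₂}) ^ k).comap mk = Ideal.span {g₂} ⊔ maximalIdeal S ^ k :=
    fun k => by
      rw [← hmkmax, ← Ideal.map_pow, Ideal.comap_map_of_surjective mk Ideal.Quotient.mk_surjective,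
        ← RingHom.ker_eq_comap_bot, hmk, Ideal.mk_ker, sup_comm]
  -- if `g₁ ∈ (g₂)` we are done
  by_cases hzero : mk g₁ = 0
  · rw [Ideal.Quotient.eq_zero_iff_mem] at hzero
    exact Ideal.mem_sup_left hzero
  -- the order `t` of `ḡ₁`
  obtain ⟨t, ht⟩ := ENat.ne_top_iff_exists.mp (adicOrder_ne_top hzero)
  have htmem : mk g₁ ∈ maximalIdeal (S ⧸ Ideal.span {g₂}) ^ t := (le_adicOrder_iff _ _).mp ht.le
  have htnot : mk g₁ ∉ maximalIdeal (S ⧸ Ideal.span {g₂}) ^ (t + 1) := (adicOrder_le_iff _ _).mp ht.ge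
  by_cases htb : w 0 ≤ w 1 * t
  · -- `t ≥ s`, hence `t ≥ m`
    have hmt : m ≤ t := by
      by_contra hlt
      push Not at hlt
      have : w 1 * t ≤ w 1 * (m - 1) := Nat.mul_le_mul_left _ (by omega)
      omega
    rw [← hcomap m, Ideal.mem_comap]
    exact Ideal.pow_le_pow_right hmt htmem
  exfalso
  push Not at htb
  -- `f = c g₁^ν + f'`, `f'` in the lower pieces `I'`
  set I' : Ideal S := (⨆ j, ⨆ (_ : j < ν), ⨆ i, ⨆ (_ : w 0 * ν ≤ w 0 * j + w 1 * i),
      Ideal.span {g₁ ^ j * x₁ ^ i}) ⊔ Ideal.span {g₁ ^ ν} * maximalIdeal S with hI'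
  have hsplit : weightedMonomialIdeal ![g₁, x₁] w (w 0 * ν) ≤ Ideal.span {g₁ ^ ν} ⊔ I' := by
    rw [weightedMonomialIdeal, Ideal.span_le]
    rintro _ ⟨α, hα, rfl⟩
    rw [Fin.sum_univ_two] at hα
    simp only [SetLike.mem_coe, Fin.prod_univ_two, Matrix.cons_val_zero, Matrix.cons_val_one]
    rcases Nat.lt_trichotomy (α 0) ν with hlt | heq | hgt
    · -- `j < ν`: a lower piece
      refine Ideal.mem_sup_right ?_
      rw [hI']
      refine Ideal.mem_sup_left ?_
      refine Ideal.mem_iSup_of_mem (α 0) (Ideal.mem_iSup_of_mem hlt (Ideal.mem_iSup_of_mem (α 1)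
        (Ideal.mem_iSup_of_mem hα (Ideal.mem_span_singleton_self _))))
    · -- `j = ν`: `x₁^i` with `i = 0` (the top coefficient) or `i ≥ 1`
      rcases Nat.eq_zero_or_pos (α 1) with hi | hi
      · rw [heq, hi, pow_zero, mul_one]
        exact Ideal.mem_sup_left (Ideal.mem_span_singleton_self _)
      · refine Ideal.mem_sup_right ?_
        rw [hI', heq]
        refine Ideal.mem_sup_right (Ideal.mul_mem_mul (Ideal.mem_span_singleton_self _) ?_)
        exact Ideal.pow_mem_of_mem _ hx₁ _ hi
    · -- `j > ν`: a multiple of `g₁^{ν+1} ∈ (g₁^ν) 𝔪`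
      refine Ideal.mem_sup_right ?_
      rw [hI']
      refine Ideal.mem_sup_right (Ideal.mul_mem_right _ _ ?_)
      obtain ⟨d, hd⟩ := Nat.exists_eq_add_of_lt hgt
      rw [hd, show ν + d + 1 = ν + (d + 1) by ring, pow_add]
      exact Ideal.mul_mem_mul (Ideal.mem_span_singleton_self _) (Ideal.pow_mem_of_mem _ hg₁ _ (Nat.succ_pos d))
  -- the lower pieces lie in `𝔪^{ν+1}` (this uses `s > 1`)
  have hI'le : I' ≤ maximalIdeal S ^ (ν + 1) := by
    rw [hI']
    refine sup_le (iSup_le fun j => iSup_le fun hj => iSup_le fun i => iSup_le fun hji => ?_) ?_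
    · rw [Ideal.span_singleton_le_iff_mem]
      have h1 : g₁ ^ j * x₁ ^ i ∈ maximalIdeal S ^ (j + i) := by
        rw [pow_add]; exact Ideal.mul_mem_mul (Ideal.pow_mem_pow hg₁ j) (Ideal.pow_mem_pow hx₁ i)
      refine Ideal.pow_le_pow_right ?_ h1
      -- `w 1 i ≥ w 0 (ν - j) > w 1 (ν - j)` ⇒ `i ≥ ν - j + 1`
      have h2 : w 0 * (ν - j) ≤ w 1 * i := by rw [Nat.mul_sub]; omega
      have h3 : w 1 * (ν - j) < w 0 * (ν - j) := Nat.mul_lt_mul_of_pos_right hs (by omega)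
      have h4 : ν - j < i := by
        by_contra hle
        push Not at hle
        have := Nat.mul_le_mul_left (w 1) hle
        omega
      omega
    · have h1 : Ideal.span {g₁ ^ ν} ≤ maximalIdeal S ^ ν := by
        rw [Ideal.span_singleton_le_iff_mem]; exact Ideal.pow_mem_pow hg₁ ν
      refine le_trans (Ideal.mul_mono_left h1) ?_
      rw [pow_succ]
  obtain ⟨a, ha, f', hf', haf⟩ := Submodule.mem_sup.mp (hsplit h₁)
  obtain ⟨c, rfl⟩ := Ideal.mem_span_singleton'.mp ha
  -- `c` is a unit
  have hc : IsUnit c := by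
    by_contra hcu
    have hcm : c ∈ maximalIdeal S := (IsLocalRing.mem_maximalIdeal _).mpr hcu
    apply hford
    rw [← haf]
    refine Ideal.add_mem _ ?_ (hI'le hf')
    have : c * g₁ ^ ν ∈ Ideal.span {g₁ ^ ν} * maximalIdeal S :=
      Submodule.mul_mem_mul_rev (Ideal.mem_span_singleton_self _) hcm
    exact hI'le (by rw [hI']; exact Ideal.mem_sup_right this)
  -- in `D`: `f̄ ∈ 𝔪_D^{νt+1}`
  have hfD : mk f ∈ maximalIdeal (S ⧸ Ideal.span {g₂}) ^ (ν * t + 1) := by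
    have hle : weightedMonomialIdeal ![g₂, x₂] w (w 0 * ν) ≤ (maximalIdeal (S ⧸ Ideal.span {g₂}) ^ (ν * t + 1)).comap mk := by
      rw [weightedMonomialIdeal, Ideal.span_le]
      rintro _ ⟨α, hα, rfl⟩
      rw [Fin.sum_univ_two] at hα
      simp only [SetLike.mem_coe, Ideal.mem_comap, Fin.prod_univ_two, Matrix.cons_val_zero, Matrix.cons_val_one,
        map_mul, map_pow]
      rcases Nat.eq_zero_or_pos (α 0) with h0 | h0
      · -- pure power of `x₂`: `w 1 α₁ ≥ w 0 ν > w 1 t ν` ⇒ `α₁ ≥ ν t + 1`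
        rw [h0, pow_zero, one_mul]
        have h1 : ν * t < α 1 := by
          by_contra hle
          push Not at hle
          have e1 : w 1 * α 1 ≤ w 1 * (ν * t) := Nat.mul_le_mul_left _ hle
          have e2 : w 1 * (ν * t) = (w 1 * t) * ν := by ring
          have e3 : (w 1 * t) * ν < w 0 * ν := Nat.mul_lt_mul_of_pos_right htb (by omega)
          rw [h0, mul_zero, zero_add] at hα
          omega
        refine Ideal.pow_le_pow_right h1 (Ideal.pow_mem_pow ?_ _)
        rw [← hmkmax]; exact Ideal.mem_map_of_mem mk hx₂
      · -- a multiple of `ḡ₂ = 0`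
        have : mk g₂ ^ α 0 = 0 := by
          rw [hmk, Ideal.Quotient.eq_zero_iff_mem.mpr (Ideal.mem_span_singleton_self g₂), zero_pow h0.ne']
        rw [this, zero_mul]
        exact Ideal.zero_mem _
    exact hle h₂
  -- in `D`: `f̄' ∈ 𝔪_D^{νt+1}`
  have hmkx₁ : mk x₁ ∈ maximalIdeal (S ⧸ Ideal.span {g₂}) := by rw [← hmkmax]; exact Ideal.mem_map_of_mem mk hx₁
  have hI'D : I'.map mk ≤ maximalIdeal (S ⧸ Ideal.span {g₂}) ^ (ν * t + 1) := by
    rw [hI', Ideal.map_sup, Ideal.map_iSup]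
    refine sup_le (iSup_le fun j => ?_) ?_
    · rw [Ideal.map_iSup]
      refine iSup_le fun hj => ?_
      rw [Ideal.map_iSup]
      refine iSup_le fun i => ?_
      rw [Ideal.map_iSup]
      refine iSup_le fun hji => ?_
      rw [Ideal.map_span, Set.image_singleton, map_mul, map_pow, map_pow, Ideal.span_singleton_le_iff_mem]
      have h1 : mk g₁ ^ j * mk x₁ ^ i ∈ maximalIdeal (S ⧸ Ideal.span {g₂}) ^ (t * j + i) := by
        rw [pow_add, pow_mul]
        exact Ideal.mul_mem_mul (Ideal.pow_mem_pow htmem j) (Ideal.pow_mem_pow hmkx₁ i)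
      refine Ideal.pow_le_pow_right ?_ h1
      -- `w 1 i ≥ w 0 (ν - j) > w 1 t (ν - j)` ⇒ `i ≥ t (ν - j) + 1`
      have h2 : w 0 * (ν - j) ≤ w 1 * i := by rw [Nat.mul_sub]; omega
      have h3 : (w 1 * t) * (ν - j) < w 0 * (ν - j) := Nat.mul_lt_mul_of_pos_right htb (by omega)
      have h4 : t * (ν - j) < i := by
        by_contra hle
        push Not at hle
        have e1 : w 1 * i ≤ w 1 * (t * (ν - j)) := Nat.mul_le_mul_left _ hle
        have e2 : w 1 * (t * (ν - j)) = (w 1 * t) * (ν - j) := by ring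
        omega
      have h5 : t * j + t * (ν - j) = t * ν := by rw [← Nat.mul_add, Nat.add_sub_cancel' hj.le]
      have h6 : ν * t = t * ν := Nat.mul_comm _ _
      omega
    · rw [Ideal.map_mul, hmkmax, Ideal.map_span, Set.image_singleton, map_pow, pow_succ]
      refine Ideal.mul_mono_left ?_
      rw [Ideal.span_singleton_le_iff_mem, Nat.mul_comm, pow_mul]
      exact Ideal.pow_mem_pow htmem ν
  have hcg : mk (c * g₁ ^ ν) ∈ maximalIdeal (S ⧸ Ideal.span {g₂}) ^ (ν * t + 1) := by
    have : mk (c * g₁ ^ ν) = mk f - mk f' := by rw [← haf, map_add, add_sub_cancel_right]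
    rw [this]
    exact Ideal.sub_mem _ hfD (hI'D (Ideal.mem_map_of_mem mk hf'))
  have hgν : mk g₁ ^ ν ∈ maximalIdeal (S ⧸ Ideal.span {g₂}) ^ (ν * t + 1) := by
    rw [map_mul, map_pow] at hcg
    obtain ⟨u, hu⟩ := hc.map mk
    have := Ideal.mul_mem_left _ (↑u⁻¹ : S ⧸ Ideal.span {g₂}) hcg
    rwa [← mul_assoc, ← hu, Units.inv_mul, one_mul] at this
  exact ContactFiltration.pow_not_mem_pow_of_not_mem_pow htnot ν hgν

end KeyStep

/-! ### (U3) Equality of the two filtrations -/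

/-- `𝔪^d ≤ weightedMonomialIdeal ![g, x] w (w 1 · d)` when `(g, x) = 𝔪` and `w 1 ≤ w 0` (every monomial of degree `d` has weight
`≥ w 1 d`). [folklore] -/
private theorem maximalIdeal_pow_le_weightedMonomialIdeal_mul [IsLocalRing S] {g x : S} (hspan : Ideal.span {g, x} = maximalIdeal S)
    (w : Fin 2 → ℕ) (hw : w 1 ≤ w 0) (d : ℕ) :
    maximalIdeal S ^ d ≤ weightedMonomialIdeal ![g, x] w (w 1 * d) := by
  induction d with
  | zero => rw [mul_zero, weightedMonomialIdeal_zero]; exact le_top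
  | succ d ih =>
    rw [pow_succ, Nat.mul_succ]
    refine le_trans (Ideal.mul_mono ih ?_) (weightedMonomialIdeal_mul_le _ w _ _)
    rw [← hspan, Ideal.span_le]
    intro y hy
    have hg : g ∈ weightedMonomialIdeal ![g, x] w (w 1) := by
      have h := pow_mul_pow_mem_weightedMonomialIdeal g x w (i := 1) (j := 0) (n := w 1) (by simpa using hw)
      rwa [pow_one, pow_zero, mul_one] at h
    have hx : x ∈ weightedMonomialIdeal ![g, x] w (w 1) := by
      have h := pow_mul_pow_mem_weightedMonomialIdeal g x w (i := 0) (j := 1) (n := w 1) (by simp)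
      rwa [pow_zero, pow_one, one_mul] at h
    rcases Set.mem_insert_iff.mp hy with rfl | hy
    · exact hg
    · rw [Set.mem_singleton_iff.mp hy]
      exact hx

/-- Powers: `y ∈ 𝒥_a ⇒ y^k ∈ 𝒥_{a k}` for the monomial ideals of a weighted chart (multiplicativity). [folklore] -/
private theorem pow_mem_weightedMonomialIdeal_mul {m : ℕ} (u : Fin m → S) (w : Fin m → ℕ) {y : S} {a : ℕ}
    (hy : y ∈ weightedMonomialIdeal u w a) (k : ℕ) : y ^ k ∈ weightedMonomialIdeal u w (a * k) := by
  induction k with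
  | zero => rw [pow_zero, mul_zero, weightedMonomialIdeal_zero]; exact Submodule.mem_top
  | succ k ih =>
    rw [pow_succ, Nat.mul_succ]
    exact weightedMonomialIdeal_mul_le u w _ _ (Ideal.mul_mem_mul ih hy)

/-- **(U3)** If `g₁ ∈ (g₂) + 𝔪^m` with `w 0 ≤ w 1 · m`, `x₁ ∈ 𝔪 = (g₂, x₂)` and `w 1 ≤ w 0`, then
`weightedMonomialIdeal ![g₁, x₁] w n ≤ weightedMonomialIdeal ![g₂, x₂] w n` (`g₁` has `g₂`-weight `≥ w 0`, `x₁` has weight `≥ w 1`,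
products add). [cite: AbramovichQuekSchober2025, Thm 3.5 proof (c)] -/
theorem weightedMonomialIdeal_le_of_mem_span_sup_pow [IsLocalRing S] {g₁ x₁ g₂ x₂ : S}
    (hspan : Ideal.span {g₂, x₂} = maximalIdeal S) (w : Fin 2 → ℕ) (hw : w 1 ≤ w 0) {m : ℕ} (hwm : w 0 ≤ w 1 * m)
    (hg₁ : g₁ ∈ Ideal.span {g₂} ⊔ maximalIdeal S ^ m) (hx₁ : x₁ ∈ maximalIdeal S) (n : ℕ) :
    weightedMonomialIdeal ![g₁, x₁] w n ≤ weightedMonomialIdeal ![g₂, x₂] w n := by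
  -- `g₂` has weight `w 0`, so has `g₁`; `x₁ ∈ 𝔪` has weight `≥ w 1`
  have hg₂w : g₂ ∈ weightedMonomialIdeal ![g₂, x₂] w (w 0) := by
    have h := pow_mul_pow_mem_weightedMonomialIdeal g₂ x₂ w (i := 1) (j := 0) (n := w 0) (by simp)
    rwa [pow_one, pow_zero, mul_one] at h
  have hg₁w : g₁ ∈ weightedMonomialIdeal ![g₂, x₂] w (w 0) := by
    obtain ⟨a, ha, r, hr, rfl⟩ := Submodule.mem_sup.mp hg₁
    obtain ⟨c, rfl⟩ := Ideal.mem_span_singleton'.mp ha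
    exact Ideal.add_mem _ (Ideal.mul_mem_left _ _ hg₂w)
      (weightedMonomialIdeal_antitone _ w hwm (maximalIdeal_pow_le_weightedMonomialIdeal_mul hspan w hw m hr))
  have hx₁w : x₁ ∈ weightedMonomialIdeal ![g₂, x₂] w (w 1) := by
    have h := maximalIdeal_pow_le_weightedMonomialIdeal_mul hspan w hw 1 (by rw [pow_one]; exact hx₁)
    rwa [mul_one] at h
  rw [weightedMonomialIdeal, Ideal.span_le]
  rintro _ ⟨α, hα, rfl⟩
  rw [Fin.sum_univ_two] at hα
  simp only [SetLike.mem_coe, Fin.prod_univ_two, Matrix.cons_val_zero, Matrix.cons_val_one]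
  exact weightedMonomialIdeal_antitone _ w hα (weightedMonomialIdeal_mul_le _ w _ _
    (Ideal.mul_mem_mul (pow_mem_weightedMonomialIdeal_mul _ w hg₁w (α 0)) (pow_mem_weightedMonomialIdeal_mul _ w hx₁w (α 1))))

/-- **AQS Theorem 3.5, proof (c) — UNIQUENESS of the lex-maximal centre's filtration, in the tree's vocabulary (clause 9 of
`IsLexMaxWeightedCentreGerm`)**: in a regular local ring, two regular systems of parameters `(g₁, x₁)`, `(g₂, x₂)` (`(gᵢ, xᵢ) = 𝔪`,
`gᵢ ∉ 𝔪²`) and weights `0 < w 1 < w 0` such that `f ∉ 𝔪^{ν+1}` (`ν ≥ 1`) is admissible for BOTH at the level `ℓ = w 0 · ν`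
define the SAME filtration `weightedMonomialIdeal ![g₁, x₁] w = weightedMonomialIdeal ![g₂, x₂] w` — no lex-maximality needed.
[cite: AbramovichQuekSchober2025, Thm 3.5 proof (c)] -/
theorem weightedMonomialIdeal_eq_of_admissible [IsRegularLocalRing S] {g₁ x₁ g₂ x₂ : S}
    (hspan₁ : Ideal.span {g₁, x₁} = maximalIdeal S) (hspan₂ : Ideal.span {g₂, x₂} = maximalIdeal S)
    (hg₁' : g₁ ∉ maximalIdeal S ^ 2) (hg₂' : g₂ ∉ maximalIdeal S ^ 2)
    (w : Fin 2 → ℕ) (hw1 : 0 < w 1) (hs : w 1 < w 0) {f : S} {ν : ℕ} (hν : 1 ≤ ν)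
    (hford : f ∉ maximalIdeal S ^ (ν + 1)) (h₁ : f ∈ weightedMonomialIdeal ![g₁, x₁] w (w 0 * ν))
    (h₂ : f ∈ weightedMonomialIdeal ![g₂, x₂] w (w 0 * ν)) (n : ℕ) :
    weightedMonomialIdeal ![g₁, x₁] w n = weightedMonomialIdeal ![g₂, x₂] w n := by
  classical
  have hg₁ : g₁ ∈ maximalIdeal S := hspan₁ ▸ Ideal.subset_span (by simp)
  have hx₁ : x₁ ∈ maximalIdeal S := hspan₁ ▸ Ideal.subset_span (by simp)
  have hg₂ : g₂ ∈ maximalIdeal S := hspan₂ ▸ Ideal.subset_span (by simp)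
  have hx₂ : x₂ ∈ maximalIdeal S := hspan₂ ▸ Ideal.subset_span (by simp)
  -- `m = ⌈w 0 / w 1⌉`
  have hex : ∃ m, w 0 ≤ w 1 * m := ⟨w 0, Nat.le_mul_of_pos_left _ hw1⟩
  set m := Nat.find hex with hmdef
  have hwm : w 0 ≤ w 1 * m := Nat.find_spec hex
  have hm : w 1 * (m - 1) < w 0 := by
    have hm0 : 0 < m := by
      by_contra h0
      push Not at h0
      have : m = 0 := by omega
      rw [this, mul_zero] at hwm
      omega
    have := Nat.find_min hex (show m - 1 < m by omega)
    omega
  exact le_antisymm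
    (weightedMonomialIdeal_le_of_mem_span_sup_pow hspan₂ w hs.le hwm
      (mem_span_sup_pow_of_mem_weightedMonomialIdeal hg₁ hx₁ hg₂ hg₂' hx₂ w hs hν hford h₁ h₂ hm) hx₁ n)
    (weightedMonomialIdeal_le_of_mem_span_sup_pow hspan₁ w hs.le hwm
      (mem_span_sup_pow_of_mem_weightedMonomialIdeal hg₂ hx₂ hg₁ hg₁' hx₁ w hs hν hford h₂ h₁ hm) hx₂ n)

end AQSHeightTwo

end Literature.AlgebraicGeometry.Resolution.WeightedInvariant

end Part5

/-!
## Part 6 — port of `Summits/ResolutionOfSingularities/ResolutionOfSingularities/Theorems/WeightedInvariantAQSBaseChangeResidueField.lean`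

# Formally smooth field extensions are relatively `p`-radically closed

Route `ResolutionOfSingularities/WeightedInvariant`, door crux `HypersurfaceCentreConstruction`
(stmt-ResolutionOfSingularities-19897) — OURS, helper; e-ladder `e = 1`: the rung
`ELadderOne.admissiblyResolvableDim_one_of_AQS` (p520391) is conditional on the vendored fact
`AbramovichQuekSchober2025_separableBaseChange` («`J` is stable under base change to separable field extensions of
`k`»); piece **(o25-δ)** «separable base change in the kernel» (res-D-pv-025 AS stub-10, OFFER 2026-08-27T09:58Z).
This file is its FIELD-THEORY BRICK: the exact point where separability of `k′/k` is used in the proof — a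
steepening `y ↦ y - λ x^b` defined over the bigger residue field `κ′ = κ(η′)` with `λ̄^{p^m} ∈ κ` must already be
defined over `κ`.

* `mem_range_algebraMap_of_pow_mem` — if `L/E` is a formally smooth extension of fields of exponential
  characteristic `p` and `y ∈ L` has `y ^ p ∈ E`, then `y ∈ E`;
* `mem_range_algebraMap_of_pow_pow_mem` — the same for `y ^ (p ^ n) ∈ E`.

Proof: if `y ^ p = a ∈ E` with `a ∉ E^p`, the `p`-basis theorem in its weakest form
(`exists_derivation_apply_eq_one_of_forall_pow_ne`, Zorn on partial derivations) gives a derivation `D` of `E`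
with `D a = 1`, while formal smoothness of `L/E` extends every derivation `E → L` to `L`, where `a = y^p` has
zero derivative (`Derivation.apply_eq_zero_of_formallySmooth`).  Both inputs are the tree's
(`Literature/FieldTheory/Separability/FormallySmoothAlgebraic.lean`); this is the relative form of Matsumura's
Thm. 26.9, "`0`-smooth ⇒ separable" [cite: Matsumura1987, Thm. 26.9; §26 (`p`-bases)].

Def-free; no named facts; nothing here is a claim about Hironaka's problem.  AI-written; weaker than expert review.
-/

section Part6


namespace Literature.AlgebraicGeometry.Resolution.WeightedInvariant.AQSBaseChange

open _root_.Literature.FieldTheory.Separability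

universe u v

variable {E : Type u} {L : Type v} [Field E] [Field L] [Algebra E L]

/-- A derivation of `E` into itself, pushed forward to values in the extension `L`. [folklore] -/
private theorem exists_derivation_algebraMap (D : Derivation ℤ E E) :
    ∃ D' : Derivation ℤ E L, ∀ a, D' a = algebraMap E L (D a) := by
  refine ⟨{ toLinearMap := ((algebraMap E L : E →+ L).comp (D.toLinearMap.toAddMonoidHom)).toIntLinearMap
            map_one_eq_zero' := by simp
            leibniz' := fun b c => by
              change algebraMap E L (D (b * c)) = b • algebraMap E L (D c) + c • algebraMap E L (D b)
              simp only [Derivation.leibniz, smul_eq_mul, map_add, map_mul, Algebra.smul_def] }, fun a => rfl⟩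

/-- **A formally smooth field extension is relatively `p`-radically closed**: if `L/E` is formally smooth, `p`
is the exponential characteristic, and `y ∈ L` satisfies `y ^ p ∈ E`, then `y ∈ E`.
[cite: Matsumura1987, Thm. 26.9] -/
theorem mem_range_algebraMap_of_pow_mem [Algebra.FormallySmooth E L] (p : ℕ) [ExpChar E p] {y : L}
    (hy : y ^ p ∈ (algebraMap E L).range) : y ∈ (algebraMap E L).range := by
  obtain ⟨a, ha⟩ := hy
  rcases ‹ExpChar E p› with _ | ⟨hprime⟩
  · exact ⟨a, by simpa using ha⟩
  · haveI : Fact p.Prime := ⟨hprime⟩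
    haveI : CharP L p := charP_of_injective_algebraMap (algebraMap E L).injective p
    haveI : ExpChar L p := ExpChar.prime hprime
    by_cases hap : ∃ b : E, b ^ p = a
    · obtain ⟨b, hb⟩ := hap
      refine ⟨b, ?_⟩
      have h : (algebraMap E L b) ^ p = y ^ p := by rw [← map_pow, hb, ha]
      exact frobenius_inj L p h
    · push Not at hap
      obtain ⟨D, hD⟩ := exists_derivation_apply_eq_one_of_forall_pow_ne p a hap
      obtain ⟨D', hD'⟩ := exists_derivation_algebraMap (L := L) D
      have h0 := Derivation.apply_eq_zero_of_formallySmooth p D' ha.symm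
      rw [hD', hD, map_one] at h0
      exact absurd h0 one_ne_zero

/-- The same for `p ^ n`-th powers: if `y ^ (p ^ n) ∈ E` then `y ∈ E`. [cite: Matsumura1987, Thm. 26.9] -/
theorem mem_range_algebraMap_of_pow_pow_mem [Algebra.FormallySmooth E L] (p : ℕ) [ExpChar E p] (n : ℕ)
    {y : L} (hy : y ^ (p ^ n) ∈ (algebraMap E L).range) : y ∈ (algebraMap E L).range := by
  induction n generalizing y with
  | zero => simpa using hy
  | succ n ih =>
    apply ih
    apply mem_range_algebraMap_of_pow_mem p
    rwa [← pow_mul, ← pow_succ]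

end Literature.AlgebraicGeometry.Resolution.WeightedInvariant.AQSBaseChange

end Part6

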